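import Literature.MathematicalPhysics.QuantumFieldTheory.Balaban1983to89.B9SupplySockB9P3ZdSrc

/-!
# `Balaban1983to89.B9SupplySockB9P3ZdAt` — THE J-N06→N05 JUNCTION WITH MEMBER-LOCAL LETTER BINDERS: the operator-letter hypotheses of
# `B9SupplySockB9P3ZdLettersOmega` ∕ `…ZdOmega` ∕ `…ZdSrc` stated AT ONE MEMBER `(M, i, m)` of the `ℤᵈ` family (not `∀ i : ZdIdx d L`), and the three
# member-level junction theorems re-proved on them — so that the family forms (companion `B9SupplySockB9P3ZdAtFamilies`) carry binder hypotheses over the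
# consumer's index map ONLY, a satisfiable hypothesis set

statement-level skeleton of published theorems with citation tags; proofs where landed; nothing here is a claim about the
Yang–Mills mass gap

PDF held: `paper:balaban1985-cmp99-background-propagators` ([4] = B9; journal page = PDF page + 388), pp. 392–399, 404; `paper:balaban1985-cmp99-regular-spaces-
gauge-fixing` (B8; journal page = PDF page + 74), pp. 77, 86–88, 92, 99, 101.

WHY THIS FILE (cell `pub-ymgap`, seat `pub-ymgap-dag-n06-b` g5; LOCATED-SELF, count-neutral).  The letter binders landed by this seat (g4 `B9SupplySockB9P3ZdLetters`,
g5 `…LettersOmega` §2, `…ZdSrc` §1) have the shape `∀ (M : ℝ) (i : ZdIdx d L) (m : ℕ), M₃ ≤ M → …`: they ask the letters `ops M i m` to behave like print's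
operators at EVERY member of the `ℤᵈ` family — including the members at which print's `G(U₀) = (Ω₀Δ_aΩ₀)⁻¹` does NOT exist: ref-A's J2′ degenerate member
(`Ω ≡ ℤᵈ`, averaging sets `Λb ≡ ∅`) is a lawful `ZdIdx`, and there {`Prop6Feed`, `CurvSmallDom`, `LandauKillsDom`, `AvgBoundDom`, `InvOnDom`} are jointly
uninhabitable (at `U₀ = 1` the constant field `c` is in E(ℤᵈ), Landau, with `J = 0`, `Q*aQc = 0` — empty averaging subtype — and `Δ′c = 0` by (3.69) for every
small α₀, so `Δ_a c = 0 = Δ_a(2c)` and (3.27) forces `c = 0`).  Hence the hypothesis SETS of the family theorems of `…ZdOmega` §4–§5 and `…ZdSrc` §4 are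
unsatisfiable as typed — the mechanism of `B8JunctionH59Vacuity` on the hypothesis side.  The member-level theorems use the binders only at their own member;
THIS FILE states the binders at one member and re-proves those three theorems verbatim on them; the companion file quantifies the binders over the index map.

WHAT IS DECLARED ∕ PROVED.  §1 (definitions) `DictAt`, `Prop6At`, `InvAt`, `CurvAt`, `LandauAt`, `AvgAt`, `HolderAt`, `GopAddAt`, `SrcAt`, `SrcHolderAt` — the
bodies of `DictGlob`, `Prop6Feed`, `InvOnDom`, `CurvSmallDom`, `LandauKillsDom`, `AvgBoundDom`, `HolderGlob`, `GopAdd`, `SourceTermDom`, `SourceHolderDom` at ONE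
`(M, i, m)` (the guard `M₃ ≤ M` moves to the family level) + the projections `…_of_global`.  §2 (theorems) `sockB9P3D4_at'`, `sockB9P3_at_univ'`,
`sockSrc_core_at_univ'` — the statements of `B9SupplySockB9P3ZdOmega.sockB9P3D4_at` ∕ `sockB9P3_at_univ` and `B9SupplySockB9P3ZdSrc.sockSrc_core_at_univ` with
member-local hypotheses; proofs identical.

HONEST SCOPE.  Typing repair of this seat's own hypothesis shape; nothing of [4] proved; the landed ∀-member theorems remain true (and follow from these by
the projections).  SATISFIABILITY of a member-local binder set: by print's objects at every member at which [4] Sect. A + Thm 3.11 hold (N06's object-bound,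
not claimed); NOT at members with an empty averaging set — which the consumer's index maps avoid (`IdxB8SubB`: Λb m m = all bonds; the cube subtype).  Count-
neutral; N05∕N06 NOT discharged; one finite lattice programme; nothing continuum ∕ ℝ⁴ ∕ OS ∕ mass-gap ∕ Clay.  Unit `pub-ymgap-dag-n06-b` (g5), 2026-08-27.
-/

noncomputable section

open NormedSpace

namespace Literature.MathematicalPhysics.QuantumFieldTheory.Balaban1983to89.B9SupplySockB9P3ZdAt

open Complex (I)
open MatrixLog B7Prop1Explicit B7Prop2Explicit B7Prop1Local B7Eq92Concrete
open B7Prop4GeneralLevels (linCovIter)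
open B7Eq78Linearization (conjR)
open B8Ineq132 (covDerivFwd covDeriv InAk BondTouches)
open B8Eq119TwistedAxial (Restr129 InAx)
open B8Eq184Proof (cfgExp)
open B8Lemma1NonAbelian (mulCfg)
open B8Eq140Level (SideTouches)
open B8Eq146AExpansion (iEta plaqCovDeriv)
open B8Eq143PlaqExpansion (pdiv)
open B8Eq155JBound (Jcur wsup)
open B8ScaledSupNorm (bondNorm msup weight Bdd)
open B8Eq138LandauZd (IsLandau138 IsLandau138W IsLandau146 IsLandau146W InR138 QT covDivB logCfg covLap)
open B8LeafModelZd (ZdIdx)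
open B8LeafModelZd3 (SockB9P3)
open B9Eq340HolderZd (hquot AdmPair trans)
open B9SupplySockB9P3ZdLetters (OpsZd deltaAOf DictGlob Prop6Feed HolderGlob)
open B9SupplySockB9P3ZdLettersOmega (OnDom restrictDom outerPart Margin2 InvOnDom CurvSmallDom LandauKillsDom AvgBoundDom SockB9P3D4)
open B9SupplySockB9P3ZdOmega (collar_arith)
open B9SupplySockB9P3ZdSrc (GopAdd SourceTermDom SourceHolderDom msup_eq_zero_of_not_bdd msup_le_add_of_norm_le hquot_add_le hquot_sub_le trans_add
  apriori_arith_src)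

-- `Site` alone could resolve to the torus sites of `Setup.lean`; re-export the `ℤ^d` sites of `B7Prop1Explicit`.
export B7Prop1Explicit (Site)

variable {d : ℕ} {𝔸 : Type*} [CStarAlgebra 𝔸]

/-! ## §1 The letter binders AT ONE MEMBER `(M, i, m)` -/

section Binders

variable {I : Type} (geo : I → B9.Geometry) (bg : I → B9.Backgrounds) (GA : ∀ i, B9.KernelFamily (geo i) (bg i))
variable (L : ℕ) (mem : ℝ → ZdIdx d L → ℕ → I)
variable (ιCfg : ∀ (M : ℝ) (i : ZdIdx d L) (m : ℕ) (U₀ : Site d → Fin d → 𝔸ˣ),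
  (∀ x κ, U₀ x κ ∈ unitaryUnits 𝔸) → (bg (mem M i m)).Cfg)
variable (ιLoc : ∀ (M : ℝ) (i : ZdIdx d L) (m : ℕ), (Site d → Fin d → 𝔸) → (geo (mem M i m)).Loc)

/-- **THE NORM DICTIONARY AT ONE MEMBER** — the body of `B9SupplySockB9P3ZdLetters.DictGlob` at `(M, i, m)`. [cite: Balaban1985BackgroundPropagators, (3.41) p.397, (3.47) p.398, Thm 3.3 p.399; Balaban1985RegularSpaces, (1.59) p.86] -/
def DictAt (ops : ℝ → ZdIdx d L → ℕ → OpsZd d 𝔸) (M : ℝ) (i : ZdIdx d L) (m : ℕ) : Prop :=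
  (geo (mem M i m)).M = M ∧
    ∀ (U₀ : Site d → Fin d → 𝔸ˣ) (hU₀ : ∀ x κ, U₀ x κ ∈ unitaryUnits 𝔸) (J : Site d → Fin d → 𝔸),
      (geo (mem M i m)).wNorm (-3) (ιLoc M i m J) = bondNorm L m i.η (-(3 : ℝ)) i.Ω J ∧
      (GA (mem M i m)).glob 0 (ιCfg M i m U₀ hU₀) (ιLoc M i m J) (-3) =
        msup L m i.η (-(1 : ℝ)) (fun j (b : Site d × Fin d) => SideTouches (i.Ω j) b.1 b.2)
          (fun b => (ops M i m).Gop U₀ J b.1 b.2) ∧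
      (GA (mem M i m)).glob 1 (ιCfg M i m U₀ hU₀) (ιLoc M i m J) (-3) =
        msup L m i.η (-(2 : ℝ)) (fun j (t : Fin d × Fin d × Site d) => SideTouches (i.Ω j) t.2.2 t.2.1)
          (fun t => covDerivFwd i.η U₀ t.1 (fun z => (ops M i m).Gop U₀ J z t.2.1) t.2.2) ∧
      (GA (mem M i m)).glob 3 (ιCfg M i m U₀ hU₀) (ιLoc M i m J) (-3) =
        bondNorm L m i.η (-(3 : ℝ)) i.Ω (fun x μ => covLap i.η U₀ (fun z => (ops M i m).Gop U₀ J z μ) x)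

/-- **B8 PROPOSITION 6 (1.136) IN [4]'s SHAPE (3.35), AT ONE MEMBER** — the body of `Prop6Feed` at `(M, i, m)`. [cite: Balaban1985RegularSpaces, Prop. 6 (1.136) p.99; Balaban1985BackgroundPropagators, (3.35) p.396] -/
def Prop6At (c35 c₆ K₆ : ℝ) (M : ℝ) (i : ZdIdx d L) (m : ℕ) : Prop :=
  ∀ (α₀ : ℝ) (U₀ : Site d → Fin d → 𝔸ˣ) (hU₀ : ∀ x κ, U₀ x κ ∈ unitaryUnits 𝔸),
    0 < α₀ → M * α₀ ≤ c₆ → InAk L m i.η α₀ i.Ω U₀ → (bg (mem M i m)).Reg335 c35 (K₆ * α₀) (ιCfg M i m U₀ hU₀)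

/-- **(3.27) ON E(Ω₀), AT ONE MEMBER** — the body of `InvOnDom` at `(M, i, m)`. [cite: Balaban1985BackgroundPropagators, (3.27) p.395, Thm 3.11 p.416; Balaban1985RegularSpaces, (1.58) p.86] -/
def InvAt (ops : ℝ → ZdIdx d L → ℕ → OpsZd d 𝔸) (c35 a₃ : ℝ) (M : ℝ) (i : ZdIdx d L) (m : ℕ) : Prop :=
  ∀ (α₀ : ℝ) (U₀ : Site d → Fin d → 𝔸ˣ) (hU₀ : ∀ x κ, U₀ x κ ∈ unitaryUnits 𝔸), 0 < α₀ → M * α₀ ≤ a₃ →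
    (bg (mem M i m)).Reg335 c35 α₀ (ιCfg M i m U₀ hU₀) →
    ∀ A : Site d → Fin d → 𝔸, OnDom L m i.η i.Ω A →
      ∀ J : Site d → Fin d → 𝔸, (∀ (y : Site d) (τ : Fin d), BondTouches (i.Ω 0) y τ → J y τ = deltaAOf i.η (ops M i m) U₀ A y τ) →
        (ops M i m).Gop U₀ J = A

/-- **(3.69) ON E(Ω₀), AT ONE MEMBER** — the body of `CurvSmallDom` at `(M, i, m)`. [cite: Balaban1985BackgroundPropagators, (3.69) p.404, (3.41) p.397] -/
def CurvAt (ops : ℝ → ZdIdx d L → ℕ → OpsZd d 𝔸) (c35 a₃ c69 : ℝ) (M : ℝ) (i : ZdIdx d L) (m : ℕ) : Prop :=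
  ∀ (α₀ : ℝ) (U₀ : Site d → Fin d → 𝔸ˣ) (hU₀ : ∀ x κ, U₀ x κ ∈ unitaryUnits 𝔸), 0 < α₀ → M * α₀ ≤ a₃ →
    (bg (mem M i m)).Reg335 c35 α₀ (ιCfg M i m U₀ hU₀) →
    ∀ A : Site d → Fin d → 𝔸, OnDom L m i.η i.Ω A → ∀ j, j ≤ m → ∀ (x : Site d) (μ : Fin d), BondTouches (i.Ω j) x μ →
      ((L : ℝ) ^ j * i.η) ^ 3 * ‖(ops M i m).Dp U₀ A x μ‖ ≤
        c69 * M * α₀ * msup L m i.η (-(1 : ℝ)) (fun j (b : Site d × Fin d) => SideTouches (i.Ω j) b.1 b.2) (fun b => A b.1 b.2)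

/-- **THE LANDAU CONDITION KILLS DRD\*, AT ONE MEMBER** — the body of `LandauKillsDom` at `(M, i, m)`. [cite: Balaban1985BackgroundPropagators, (3.20)–(3.21) p.394; Balaban1985RegularSpaces, (1.42) p.83] -/
def LandauAt (ops : ℝ → ZdIdx d L → ℕ → OpsZd d 𝔸) (c35 a₃ : ℝ) (M : ℝ) (i : ZdIdx d L) (m : ℕ) : Prop :=
  ∀ (α₀ : ℝ) (U₀ : Site d → Fin d → 𝔸ˣ) (hU₀ : ∀ x κ, U₀ x κ ∈ unitaryUnits 𝔸), 0 < α₀ → M * α₀ ≤ a₃ →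
    (bg (mem M i m)).Reg335 c35 α₀ (ιCfg M i m U₀ hU₀) →
    ∀ A : Site d → Fin d → 𝔸, OnDom L m i.η i.Ω A → IsLandau138 L m i.η (i.Ω 0) (i.Λs m) U₀ A →
      ∀ (x : Site d) (μ : Fin d), (ops M i m).DRDs U₀ A x μ = 0

/-- **THE AVERAGING TERM IS BOUNDED BY |B₁|, AT ONE MEMBER** — the body of `AvgBoundDom` at `(M, i, m)`. [cite: Balaban1985BackgroundPropagators, (3.16) p.393; Balaban1985RegularSpaces, (1.56) p.86] -/
def AvgAt (ops : ℝ → ZdIdx d L → ℕ → OpsZd d 𝔸) (q : ℝ) (M : ℝ) (i : ZdIdx d L) (m : ℕ) : Prop :=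
  ∀ (U₀ : Site d → Fin d → 𝔸ˣ), (∀ x κ, U₀ x κ ∈ unitaryUnits 𝔸) →
    ∀ A : Site d → Fin d → 𝔸, OnDom L m i.η i.Ω A → ∀ j, j ≤ m → ∀ (x : Site d) (μ : Fin d), BondTouches (i.Ω j) x μ →
      ((L : ℝ) ^ j * i.η) ^ 3 * ‖(ops M i m).QQ U₀ A x μ‖ ≤
        q * wsup 1 (fun p : {p : ℕ × (Site d × Fin d) // p.1 ≤ m ∧ p.2 ∈ i.Λb m p.1} =>
              linCovIter L U₀ (iEta i.η A) p.1.1 p.1.2.1 p.1.2.2)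

/-- **THE GLOBAL WEIGHTED HÖLDER NORM OF ∇_{U₀}G(U₀), AT ONE MEMBER** — the body of `B9SupplySockB9P3ZdLetters.HolderGlob` at `(M, i, m)`.
[cite: Balaban1985RegularSpaces, Prop. 3 p.87, (1.59) p.86; Balaban1985BackgroundPropagators, (3.43), (3.47) p.398] -/
def HolderAt (ops : ℝ → ZdIdx d L → ℕ → OpsZd d 𝔸) (β : ℝ) (len : Site d → ℝ) (CH : ℝ) (M : ℝ) (i : ZdIdx d L) (m : ℕ) : Prop :=
  ∀ (Bβ Bε : ℝ → ℝ) (Bεβ : ℝ → ℝ → ℝ) (δ₀ : ℝ) (U₀ : Site d → Fin d → 𝔸ˣ) (hU₀ : ∀ x κ, U₀ x κ ∈ unitaryUnits 𝔸),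
    B9.Ineq343_345 (GA (mem M i m)) Bβ Bε Bεβ δ₀ (ιCfg M i m U₀ hU₀) →
    ∀ J : Site d → Fin d → 𝔸,
      msup L m i.η (-(2 + β)) (fun j (q : Fin d × Fin d × (Site d × Site d)) => q.2.2 ∈ AdmPair i.η len ∧ q.2.2.1 ∈ i.Ω j)
          (fun q => hquot i.η β len U₀ (covDerivFwd i.η U₀ q.1 (fun z => (ops M i m).Gop U₀ J z q.2.1)) q.2.2)
        ≤ CH * Bβ β * bondNorm L m i.η (-(3 : ℝ)) i.Ω J

/-- **`G(U₀)` IS ADDITIVE, AT ONE MEMBER** — the body of `GopAdd` at `(M, i, m)`. [cite: Balaban1985BackgroundPropagators, (3.27) p.395] -/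
def GopAddAt (ops : ℝ → ZdIdx d L → ℕ → OpsZd d 𝔸) (M : ℝ) (i : ZdIdx d L) (m : ℕ) : Prop :=
  ∀ (U₀ : Site d → Fin d → 𝔸ˣ) (J₁ J₂ : Site d → Fin d → 𝔸),
    (ops M i m).Gop U₀ (J₁ + J₂) = (ops M i m).Gop U₀ J₁ + (ops M i m).Gop U₀ J₂

/-- **THE SOURCE TERM THROUGH `G(U₀)D R(U₀)`, AT ONE MEMBER** — the body of `SourceTermDom` at `(M, i, m)`. [cite: Balaban1985RegularSpaces, (1.146) + Thm 8 p.101, p.92; Balaban1985BackgroundPropagators, (3.20)–(3.27) pp.394–395, (3.42), (3.47) p.398] -/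
def SrcAt (ops : ℝ → ZdIdx d L → ℕ → OpsZd d 𝔸) (c35 a₃ cS : ℝ) (M : ℝ) (i : ZdIdx d L) (m : ℕ) : Prop :=
  ∀ (α₀ : ℝ) (U₀ : Site d → Fin d → 𝔸ˣ) (hU₀ : ∀ x κ, U₀ x κ ∈ unitaryUnits 𝔸), 0 < α₀ → M * α₀ ≤ a₃ →
    (bg (mem M i m)).Reg335 c35 α₀ (ιCfg M i m U₀ hU₀) →
    ∀ A : Site d → Fin d → 𝔸, OnDom L m i.η i.Ω A →
    ∀ f : Site d → 𝔸, Bdd L i.k i.η (-(2 : ℝ)) (fun j (x : Site d) => x ∈ i.Ω j) f →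
      (∃ μ : ℕ → Site d → 𝔸, ∀ x ∈ i.Ω 0,
        covLap i.η U₀ ((i.Ω 0).indicator (covDivB i.η U₀ A - f)) x = QT L m (i.Λs m) U₀ μ x) →
      (∃ C : ℝ, ∀ (y : Site d) (τ : Fin d), ‖(ops M i m).Gop U₀ (fun z κ => (ops M i m).DRDs U₀ A z κ) y τ‖ ≤ C) ∧
      msup L m i.η (-(1 : ℝ)) (fun j (b : Site d × Fin d) => SideTouches (i.Ω j) b.1 b.2)
          (fun b => (ops M i m).Gop U₀ (fun z κ => (ops M i m).DRDs U₀ A z κ) b.1 b.2) ≤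
        cS * msup L i.k i.η (-(2 : ℝ)) (fun j (x : Site d) => x ∈ i.Ω j) f ∧
      msup L m i.η (-(2 : ℝ)) (fun j (t : Fin d × Fin d × Site d) => SideTouches (i.Ω j) t.2.2 t.2.1)
          (fun t => covDerivFwd i.η U₀ t.1 (fun z => (ops M i m).Gop U₀ (fun z κ => (ops M i m).DRDs U₀ A z κ) z t.2.1) t.2.2) ≤
        cS * msup L i.k i.η (-(2 : ℝ)) (fun j (x : Site d) => x ∈ i.Ω j) f ∧
      bondNorm L m i.η (-(3 : ℝ)) i.Ω
          (fun x μ => covLap i.η U₀ (fun z => (ops M i m).Gop U₀ (fun z κ => (ops M i m).DRDs U₀ A z κ) z μ) x) ≤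
        cS * msup L i.k i.η (-(2 : ℝ)) (fun j (x : Site d) => x ∈ i.Ω j) f

/-- **THE HÖLDER LINE OF THE SOURCE TERM, AT ONE MEMBER** — the body of `SourceHolderDom` at `(M, i, m)`. [cite: Balaban1985RegularSpaces, Thm 8 p.101, (1.39) p.82; Balaban1985BackgroundPropagators, (3.43) p.398] -/
def SrcHolderAt (ops : ℝ → ZdIdx d L → ℕ → OpsZd d 𝔸) (c35 a₃ : ℝ) (β : ℝ) (len : Site d → ℝ) (cSβ : ℝ) (M : ℝ) (i : ZdIdx d L) (m : ℕ) :
    Prop :=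
  ∀ (α₀ : ℝ) (U₀ : Site d → Fin d → 𝔸ˣ) (hU₀ : ∀ x κ, U₀ x κ ∈ unitaryUnits 𝔸), 0 < α₀ → M * α₀ ≤ a₃ →
    (bg (mem M i m)).Reg335 c35 α₀ (ιCfg M i m U₀ hU₀) →
    ∀ A : Site d → Fin d → 𝔸, OnDom L m i.η i.Ω A →
    ∀ f : Site d → 𝔸, Bdd L i.k i.η (-(2 : ℝ)) (fun j (x : Site d) => x ∈ i.Ω j) f →
      (∃ μ : ℕ → Site d → 𝔸, ∀ x ∈ i.Ω 0,
        covLap i.η U₀ ((i.Ω 0).indicator (covDivB i.η U₀ A - f)) x = QT L m (i.Λs m) U₀ μ x) →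
      Bdd L m i.η (-(2 + β)) (fun j (q : Fin d × Fin d × (Site d × Site d)) => q.2.2 ∈ AdmPair i.η len ∧ q.2.2.1 ∈ i.Ω j)
          (fun q => hquot i.η β len U₀
            (covDerivFwd i.η U₀ q.1 (fun z => (ops M i m).Gop U₀ (fun z κ => (ops M i m).DRDs U₀ A z κ) z q.2.1)) q.2.2) ∧
      msup L m i.η (-(2 + β)) (fun j (q : Fin d × Fin d × (Site d × Site d)) => q.2.2 ∈ AdmPair i.η len ∧ q.2.2.1 ∈ i.Ω j)
          (fun q => hquot i.η β len U₀
            (covDerivFwd i.η U₀ q.1 (fun z => (ops M i m).Gop U₀ (fun z κ => (ops M i m).DRDs U₀ A z κ) z q.2.1)) q.2.2) ≤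
        cSβ * msup L i.k i.η (-(2 : ℝ)) (fun j (x : Site d) => x ∈ i.Ω j) f

/-! ### The projections from the landed ∀-member binders -/

variable {geo bg GA L mem ιCfg ιLoc}

/-- `DictGlob` gives `DictAt` at every member. [cite: Balaban1985BackgroundPropagators, (3.47) p.398] -/
theorem dictAt_of_global {ops : ℝ → ZdIdx d L → ℕ → OpsZd d 𝔸} (h : DictGlob geo bg GA L mem ιCfg ιLoc ops) (M : ℝ) (i : ZdIdx d L) (m : ℕ) :
    DictAt geo bg GA L mem ιCfg ιLoc ops M i m := h M i m

/-- `Prop6Feed` gives `Prop6At` at every member with `M₃ ≤ M`. [cite: Balaban1985RegularSpaces, Prop. 6 (1.136) p.99] -/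
theorem prop6At_of_global {c35 M₃ c₆ K₆ : ℝ} (h : Prop6Feed bg L mem ιCfg c35 M₃ c₆ K₆) {M : ℝ} (hM : M₃ ≤ M) (i : ZdIdx d L) (m : ℕ) :
    Prop6At bg L mem ιCfg c35 c₆ K₆ M i m := h M i m hM

/-- `InvOnDom` gives `InvAt` at every member with `M₃ ≤ M`. [cite: Balaban1985BackgroundPropagators, (3.27) p.395] -/
theorem invAt_of_global {ops : ℝ → ZdIdx d L → ℕ → OpsZd d 𝔸} {c35 M₃ a₃ : ℝ} (h : InvOnDom bg L mem ιCfg ops c35 M₃ a₃) {M : ℝ} (hM : M₃ ≤ M)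
    (i : ZdIdx d L) (m : ℕ) : InvAt bg L mem ιCfg ops c35 a₃ M i m := h M i m hM

/-- `CurvSmallDom` gives `CurvAt` at every member with `M₃ ≤ M`. [cite: Balaban1985BackgroundPropagators, (3.69) p.404] -/
theorem curvAt_of_global {ops : ℝ → ZdIdx d L → ℕ → OpsZd d 𝔸} {c35 M₃ a₃ c69 : ℝ} (h : CurvSmallDom bg L mem ιCfg ops c35 M₃ a₃ c69) {M : ℝ}
    (hM : M₃ ≤ M) (i : ZdIdx d L) (m : ℕ) : CurvAt bg L mem ιCfg ops c35 a₃ c69 M i m := h M i m hM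

/-- `LandauKillsDom` gives `LandauAt` at every member with `M₃ ≤ M`. [cite: Balaban1985BackgroundPropagators, (3.20)–(3.21) p.394] -/
theorem landauAt_of_global {ops : ℝ → ZdIdx d L → ℕ → OpsZd d 𝔸} {c35 M₃ a₃ : ℝ} (h : LandauKillsDom bg L mem ιCfg ops c35 M₃ a₃) {M : ℝ}
    (hM : M₃ ≤ M) (i : ZdIdx d L) (m : ℕ) : LandauAt bg L mem ιCfg ops c35 a₃ M i m := h M i m hM

/-- `AvgBoundDom` gives `AvgAt` at every member. [cite: Balaban1985BackgroundPropagators, (3.16) p.393] -/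
theorem avgAt_of_global {ops : ℝ → ZdIdx d L → ℕ → OpsZd d 𝔸} {q : ℝ} (h : AvgBoundDom L ops q) (M : ℝ) (i : ZdIdx d L) (m : ℕ) :
    AvgAt L ops q M i m := h M i m

/-- `HolderGlob` gives `HolderAt` at every member. [cite: Balaban1985BackgroundPropagators, (3.43) p.398] -/
theorem holderAt_of_global {ops : ℝ → ZdIdx d L → ℕ → OpsZd d 𝔸} {β : ℝ} {len : Site d → ℝ} {CH : ℝ} (h : HolderGlob geo bg GA L mem ιCfg ops β len CH)
    (M : ℝ) (i : ZdIdx d L) (m : ℕ) : HolderAt geo bg GA L mem ιCfg ops β len CH M i m := h M i m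

/-- `GopAdd` gives `GopAddAt` at every member. [cite: Balaban1985BackgroundPropagators, (3.27) p.395] -/
theorem gopAddAt_of_global {ops : ℝ → ZdIdx d L → ℕ → OpsZd d 𝔸} (h : GopAdd L ops) (M : ℝ) (i : ZdIdx d L) (m : ℕ) :
    GopAddAt L ops M i m := h M i m

/-- `SourceTermDom` gives `SrcAt` at every member with `M₃ ≤ M`. [cite: Balaban1985RegularSpaces, Thm 8 p.101] -/
theorem srcAt_of_global {ops : ℝ → ZdIdx d L → ℕ → OpsZd d 𝔸} {c35 M₃ a₃ cS : ℝ} (h : SourceTermDom bg L mem ιCfg ops c35 M₃ a₃ cS) {M : ℝ}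
    (hM : M₃ ≤ M) (i : ZdIdx d L) (m : ℕ) : SrcAt bg L mem ιCfg ops c35 a₃ cS M i m := h M i m hM

/-- `SourceHolderDom` gives `SrcHolderAt` at every member with `M₃ ≤ M`. [cite: Balaban1985RegularSpaces, Thm 8 p.101] -/
theorem srcHolderAt_of_global {ops : ℝ → ZdIdx d L → ℕ → OpsZd d 𝔸} {c35 M₃ a₃ β : ℝ} {len : Site d → ℝ} {cSβ : ℝ}
    (h : SourceHolderDom bg L mem ιCfg ops c35 M₃ a₃ β len cSβ) {M : ℝ} (hM : M₃ ≤ M) (i : ZdIdx d L) (m : ℕ) :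
    SrcHolderAt bg L mem ιCfg ops c35 a₃ β len cSβ M i m := h M i m hM

end Binders

/-! ## §2 The three member-level junction theorems on member-local binders -/

section Supply

variable [Nontrivial 𝔸]
variable {I : Type} (geo : I → B9.Geometry) (bg : I → B9.Backgrounds) (GA : ∀ i, B9.KernelFamily (geo i) (bg i))
variable (L : ℕ) (mem : ℝ → ZdIdx d L → ℕ → I)
variable (ιCfg : ∀ (M : ℝ) (i : ZdIdx d L) (m : ℕ) (U₀ : Site d → Fin d → 𝔸ˣ),
  (∀ x κ, U₀ x κ ∈ unitaryUnits 𝔸) → (bg (mem M i m)).Cfg)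
variable (ιLoc : ∀ (M : ℝ) (i : ZdIdx d L) (m : ℕ), (Site d → Fin d → 𝔸) → (geo (mem M i m)).Loc)
variable (ops : ℝ → ZdIdx d L → ℕ → OpsZd d 𝔸)

-- budget line (ops-buildfix standing ask for 100+-line weighted-norm proofs; elaborates well inside the default today)
set_option maxHeartbeats 400000 in
/-- **(MEMBER-LOCAL HYPOTHESES — `B9SupplySockB9P3ZdOmega.sockB9P3D4_at` re-proved on the At-binders.)  THEOREM 3.3 FOR G(U₀) AT ONE MEMBER WITH `Margin2` SUPPLIES THE FOUR-LINE COLLAR SOCKET AT THAT DATUM AND LEVEL** (B8 p. 86 «Theorem 3.3 of [4]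
implies the bounds (1.59)», on print's field class E(Ω₀), with the located Δ′-transfer G-IF-01, the constant repair of `B8FromB9.b8_159_repaired`, and the
tree's exterior bookkeeping).  Data: the [B9] frame with the member readings `DictGlob`, the E(Ω₀)-binders `InvOnDom`∕`CurvSmallDom`∕`LandauKillsDom`∕
`AvgBoundDom`, Prop. 6 `Prop6Feed`, a block parameter `M ≥ max{1, M₃}`, a member `i` whose domain sequence has `Margin2`, a level `m ≤ k`, and THEOREM
3.3's (3.42)∕(3.46)∕(3.47) block of the member `(M, i, m)` as the hypothesis `h33U`.  Conclusion: `SockB9P3D4` at level `m` with B₀′ = max{1, 2B₀max{1,q}},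
B_∂ = (20d + 2)B₀′, cP = min{1∕16, c₆∕M, a₀∕(K₆M), a₃∕(K₆M), 1∕(2B₀c₆₉K₆M + 1)}.
[cite: Balaban1985RegularSpaces, (1.58)–(1.59) p.86, Prop. 3 p.87, p.77; Balaban1985BackgroundPropagators, Thm 3.3 p.399, (3.26)–(3.27) p.395, (3.47) p.398, (3.69) p.404] -/
theorem sockB9P3D4_at' (hd2 : 2 ≤ d) (hL : 1 ≤ L) {c35 c₆ K₆ a₃ c69 q : ℝ}
    {M : ℝ} (hM1 : 1 ≤ M) (i : ZdIdx d L) (hMi : Margin2 i.Ω) {m : ℕ} (hm : m ≤ i.k)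
    (hdict : DictAt geo bg GA L mem ιCfg ιLoc ops M i m) (hP6 : Prop6At bg L mem ιCfg c35 c₆ K₆ M i m)
    (hinv : InvAt bg L mem ιCfg ops c35 a₃ M i m) (hcurv : CurvAt bg L mem ιCfg ops c35 a₃ c69 M i m)
    (hlan : LandauAt bg L mem ιCfg ops c35 a₃ M i m) (havg : AvgAt L ops q M i m)
    (hK₆ : 0 < K₆) (hc69 : 0 ≤ c69) (hq : 0 ≤ q)
    {B₀ δ₀ a₀ : ℝ} (hB₀ : 0 < B₀)
    (h33U : ∀ (α₀ : ℝ) (U₀ : Site d → Fin d → 𝔸ˣ) (hU₀ : ∀ x κ, U₀ x κ ∈ unitaryUnits 𝔸), 0 < α₀ → M * α₀ ≤ a₀ →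
      (bg (mem M i m)).Reg335 c35 α₀ (ιCfg M i m U₀ hU₀) →
      B9.Ineq342_346_347 (GA (mem M i m)) B₀ δ₀ (ιCfg M i m U₀ hU₀)) :
    SockB9P3D4 (𝔸 := 𝔸) L (max 1 (2 * B₀ * max 1 q)) ((20 * d + 2) * max 1 (2 * B₀ * max 1 q))
      (min (1 / 16) (min (c₆ / M) (min (a₀ / (K₆ * M)) (min (a₃ / (K₆ * M)) (1 / (2 * B₀ * c69 * K₆ * M + 1))))))
      i.η m i.Ω i.Λs i.Λb := by
  intro α₀ α₂ hα₀ hα₀c hα₂ hα₂c U₀ W hU₀ hWu hInA _ hLanW A' _ h41 hA0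
  -- the thresholds
  have hη : 0 < i.η := i.hη
  have hLr : (1 : ℝ) ≤ L := by exact_mod_cast hL
  have hd1 : (1 : ℝ) ≤ d := by exact_mod_cast (le_trans (by norm_num) hd2 : 1 ≤ d)
  have hM0 : 0 < M := lt_of_lt_of_le one_pos hM1
  have hKM : 0 < K₆ * M := mul_pos hK₆ hM0
  simp only [le_min_iff] at hα₀c hα₂c
  obtain ⟨-, hα₀c6, hα₀a0, hα₀a3, hα₀θ⟩ := hα₀c
  obtain ⟨hα₂16, -, -, -, -⟩ := hα₂c
  have hc6 : M * α₀ ≤ c₆ := by rw [mul_comm]; exact (le_div_iff₀ hM0).1 hα₀c6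
  have ha₉0 : 0 < K₆ * α₀ := mul_pos hK₆ hα₀
  have ha0' : M * (K₆ * α₀) ≤ a₀ := by
    have h := (le_div_iff₀ hKM).1 hα₀a0
    calc M * (K₆ * α₀) = α₀ * (K₆ * M) := by ring
      _ ≤ a₀ := h
  have ha3' : M * (K₆ * α₀) ≤ a₃ := by
    have h := (le_div_iff₀ hKM).1 hα₀a3
    calc M * (K₆ * α₀) = α₀ * (K₆ * M) := by ring
      _ ≤ a₃ := h
  have hκ' : 0 ≤ c69 * M * (K₆ * α₀) := by positivity
  have hθ : B₀ * (c69 * M * (K₆ * α₀)) ≤ 1 / 2 := by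
    have hpos : 0 < 2 * B₀ * c69 * K₆ * M + 1 := by positivity
    have h1 : α₀ * (2 * B₀ * c69 * K₆ * M + 1) ≤ 1 := (le_div_iff₀ hpos).1 hα₀θ
    linarith [hα₀.le]
  -- (3.35) for U₀ by Proposition 6, and Theorem 3.3's (3.42)–(3.47) block for G(U₀)
  have hreg : (bg (mem M i m)).Reg335 c35 (K₆ * α₀) (ιCfg M i m U₀ hU₀) := hP6 α₀ U₀ hU₀ hα₀ hc6 hInA
  have h347 := h33U (K₆ * α₀) U₀ hU₀ ha₉0 ha0' hreg
  obtain ⟨-, hd⟩ := hdict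
  have hU₀1 : ∀ x κ, U₀ x κ ∈ U1 𝔸 := fun x κ => unitaryUnits_le_U1 (hU₀ x κ)
  -- the datum and its restriction to the Ω₀-bonds
  have hAglob : ∀ (y : Site d) (τ : Fin d), ‖A' y τ‖ ≤ α₂ * i.η⁻¹ := by
    intro y τ
    by_cases hmem : ∃ j, j ≤ m ∧ SideTouches (i.Ω j) y τ
    · obtain ⟨j, hj, hs⟩ := hmem
      have hLj : (1 : ℝ) ≤ (L : ℝ) ^ j := one_le_pow₀ hLr
      calc ‖A' y τ‖ ≤ α₂ * ((L : ℝ) ^ j * i.η)⁻¹ := (h41 j hj y τ hs).2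
        _ = α₂ * i.η⁻¹ * ((L : ℝ) ^ j)⁻¹ := by rw [mul_inv]; ring
        _ ≤ α₂ * i.η⁻¹ * 1 := by
            apply mul_le_mul_of_nonneg_left (inv_le_one_of_one_le₀ hLj) (by positivity)
        _ = α₂ * i.η⁻¹ := mul_one _
    · rw [hA0 y τ fun j hj hs => hmem ⟨j, hj, hs⟩, norm_zero]
      positivity
  have hAbd : Bdd L m i.η (-(1 : ℝ)) (fun j (b : Site d × Fin d) => SideTouches (i.Ω j) b.1 b.2) (fun b => A' b.1 b.2) := by
    have e1 : (-(1 : ℝ)) = -((1 : ℕ) : ℝ) := by norm_num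
    rw [e1]
    refine B8ScaledSupNorm.bdd_of_forall (c := α₂) fun j hj b hb => ?_
    rw [B8ScaledSupNorm.weight_neg_natCast, pow_one]
    have h := (h41 j hj b.1 b.2 hb).2
    have hs : 0 < (L : ℝ) ^ j * i.η := B8ScaledSupNorm.scale_pos hL hη j
    calc (L : ℝ) ^ j * i.η * ‖A' b.1 b.2‖ ≤ (L : ℝ) ^ j * i.η * (α₂ * ((L : ℝ) ^ j * i.η)⁻¹) :=
          mul_le_mul_of_nonneg_left h hs.le
      _ = α₂ := by rw [mul_comm α₂, ← mul_assoc, mul_inv_cancel₀ hs.ne', one_mul]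
  obtain ⟨Ain, hAin_def⟩ : ∃ Ain : Site d → Fin d → 𝔸, Ain = restrictDom (i.Ω 0) A' := ⟨_, rfl⟩
  have h41b : ∀ j, j ≤ m → ∀ (y : Site d) (τ : Fin d), SideTouches (i.Ω j) y τ → ‖A' y τ‖ ≤ α₂ * ((L : ℝ) ^ j * i.η)⁻¹ :=
    fun j hj y τ hs => (h41 j hj y τ hs).2
  have hOn : OnDom L m i.η i.Ω Ain := by
    rw [hAin_def]; exact B9SupplySockB9P3ZdLettersOmega.onDom_restrictDom hL hη h41b
  have hAin_glob : ∀ (y : Site d) (τ : Fin d), ‖Ain y τ‖ ≤ α₂ * i.η⁻¹ := fun y τ => by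
    rw [hAin_def]; exact (B9SupplySockB9P3ZdLettersOmega.norm_restrictDom_le _ A' y τ).trans (hAglob y τ)
  obtain ⟨a, ha_def⟩ : ∃ a : ℝ,
      a = msup L m i.η (-(1 : ℝ)) (fun j (b : Site d × Fin d) => SideTouches (i.Ω j) b.1 b.2) (fun b => Ain b.1 b.2) := ⟨_, rfl⟩
  have ha0 : 0 ≤ a := by rw [ha_def]; exact B8ScaledSupNorm.msup_nonneg L m hη.le _ _ _
  -- the collar functional Φ₀ and the pointwise control of the outer part
  obtain ⟨Φ, hΦ_def⟩ : ∃ Φ : ℝ, Φ = msup L m i.η (-(1 : ℝ))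
      (fun j (b : Site d × Fin d) => j = 0 ∧ SideTouches (i.Ω 0) b.1 b.2 ∧ ¬ BondTouches (i.Ω 0) b.1 b.2) (fun b => A' b.1 b.2) := ⟨_, rfl⟩
  have hΦ0 : 0 ≤ Φ := by rw [hΦ_def]; exact B8ScaledSupNorm.msup_nonneg L m hη.le _ _ _
  have hbdΦ : Bdd L m i.η (-(1 : ℝ))
      (fun j (b : Site d × Fin d) => j = 0 ∧ SideTouches (i.Ω 0) b.1 b.2 ∧ ¬ BondTouches (i.Ω 0) b.1 b.2) (fun b => A' b.1 b.2) := by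
    have e1 : (-(1 : ℝ)) = -((1 : ℕ) : ℝ) := by norm_num
    rw [e1]
    exact B9SupplySockB9P3ZdLettersOmega.bdd_neg_of_pointwise hL hη 1 fun b => hAglob b.1 b.2
  have hout : ∀ (y : Site d) (τ : Fin d), ‖outerPart (i.Ω 0) A' y τ‖ ≤ i.η⁻¹ * Φ := by
    intro y τ; rw [hΦ_def]
    exact B9SupplySockB9P3ZdLettersOmega.norm_outerPart_le_phi hη hMi hA0 hbdΦ y τ
  -- the Landau condition for A′, hence for 𝟙_{Ω₀}A′; the source J̃ = Δ_a(U₀)𝟙_{Ω₀}A′ and 𝟙_{Ω₀}A′ = G(U₀)J̃ ((1.58))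
  have hLanA : IsLandau138 L m i.η (i.Ω 0) (i.Λs m) U₀ A' :=
    B9SupplySockB9P3Zd.landau_of_landauW hd2 hη U₀ hWu hα₂16 h41 hLanW
  have hLanAin : IsLandau138 L m i.η (i.Ω 0) (i.Λs m) U₀ Ain := by
    rw [hAin_def]; exact (B9SupplySockB9P3ZdLettersOmega.isLandau138_restrictDom_iff L m i.η (i.Ω 0) (i.Λs m) U₀ A').2 hLanA
  obtain ⟨Jt, hJt_def⟩ : ∃ Jt : Site d → Fin d → 𝔸, Jt = deltaAOf i.η (ops M i m) U₀ Ain := ⟨_, rfl⟩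
  have hGJ : (ops M i m).Gop U₀ Jt = Ain :=
    hinv (K₆ * α₀) U₀ hU₀ ha₉0 ha3' hreg Ain hOn Jt fun y τ _ => by rw [hJt_def]
  have hDRD : ∀ (x : Site d) (μ : Fin d), (ops M i m).DRDs U₀ Ain x μ = 0 :=
    hlan (K₆ * α₀) U₀ hU₀ ha₉0 ha3' hreg Ain hOn hLanAin
  have hJtb : ∀ (x : Site d) (μ : Fin d),
      Jt x μ = Jcur i.η U₀ Ain μ x + (ops M i m).Dp U₀ Ain x μ + (ops M i m).DRDs U₀ Ain x μ + (ops M i m).QQ U₀ Ain x μ := by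
    intro x μ; rw [hJt_def]; rfl
  -- the right-hand side quantities: |J|₍₋₃₎ of the datum, |J(𝟙_{Ω₀}A′)|₍₋₃₎, |B₁|
  obtain ⟨nJ, hnJ_def⟩ : ∃ nJ : ℝ, nJ = bondNorm L m i.η (-(3 : ℝ)) i.Ω (fun x μ => Jcur i.η U₀ A' μ x) := ⟨_, rfl⟩
  obtain ⟨nJi, hnJi_def⟩ : ∃ nJi : ℝ, nJi = bondNorm L m i.η (-(3 : ℝ)) i.Ω (fun x μ => Jcur i.η U₀ Ain μ x) := ⟨_, rfl⟩
  obtain ⟨nB, hnB_def⟩ : ∃ nB : ℝ, nB = wsup 1 (fun p : {p : ℕ × (Site d × Fin d) // p.1 ≤ m ∧ p.2 ∈ i.Λb m p.1} =>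
      linCovIter L U₀ (iEta i.η A') p.1.1 p.1.2.1 p.1.2.2) := ⟨_, rfl⟩
  have hnJ0 : 0 ≤ nJ := by rw [hnJ_def]; exact B8ScaledSupNorm.msup_nonneg L m hη.le _ _ _
  have hnB0 : 0 ≤ nB := by rw [hnB_def]; exact B8Eq155JBound.wsup_nonneg zero_le_one _
  have hnB_eq : wsup 1 (fun p : {p : ℕ × (Site d × Fin d) // p.1 ≤ m ∧ p.2 ∈ i.Λb m p.1} =>
      linCovIter L U₀ (iEta i.η Ain) p.1.1 p.1.2.1 p.1.2.2) = nB := by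
    rw [hnB_def, hAin_def]
    exact B9SupplySockB9P3ZdLettersOmega.wsupB1_restrictDom hL m i.η (B9SupplySockB9P3ZdLettersOmega.hbox_zero i hm) U₀ A'
  -- |J(𝟙_{Ω₀}A′)|₍₋₃₎ ≤ |J(A′)|₍₋₃₎ + 16dΦ (the outer part sits at level 0)
  have hnJi_le : nJi ≤ nJ + 16 * d * Φ := by
    rw [hnJi_def, hnJ_def, hAin_def]
    exact B9SupplySockB9P3ZdLettersOmega.bondNorm_jcur_restrict_le hL hη hMi hU₀1 hΦ0 hout hAglob
  -- the current of 𝟙_{Ω₀}A′ is bounded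
  have hgrad : ∀ (y : Site d) (κ τ : Fin d), ‖covDerivFwd i.η U₀ κ (fun z => Ain z τ) y‖ ≤ i.η⁻¹ * (α₂ * i.η⁻¹ + α₂ * i.η⁻¹) :=
    fun y κ τ => (B9SupplySockB9P3ZdLettersOmega.norm_covDerivFwd_le hη (hU₀1 _ _) _).trans
      (mul_le_mul_of_nonneg_left (add_le_add (hAin_glob _ _) (hAin_glob _ _)) (inv_nonneg.mpr hη.le))
  have hJbd : Bdd L m i.η (-(3 : ℝ)) (fun j (b : Site d × Fin d) => BondTouches (i.Ω j) b.1 b.2)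
      (fun b => Jcur i.η U₀ Ain b.2 b.1) :=
    B9SupplySockB9P3Zd.bdd_neg_three_of_pointwise hL hη fun b => B9SupplySockB9P3Zd.norm_Jcur_le_of_grad hη hU₀1 hgrad b.2 b.1
  -- |J̃|₍₋₃₎ ≤ |J(𝟙_{Ω₀}A′)|₍₋₃₎ + c₆₉ M α₀ |𝟙_{Ω₀}A′|₍₋₁₎ + q |B₁| (pointwise: (3.26) with (3.69), the Landau condition, (3.16))
  have hJt : bondNorm L m i.η (-(3 : ℝ)) i.Ω Jt ≤ nJi + c69 * M * (K₆ * α₀) * a + q * nB := by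
    have e3 : (-(3 : ℝ)) = -((3 : ℕ) : ℝ) := by norm_num
    have hnJi0 : 0 ≤ nJi := by rw [hnJi_def]; exact B8ScaledSupNorm.msup_nonneg L m hη.le _ _ _
    refine B8ScaledSupNorm.msup_le (by positivity) fun j hj b hb => ?_
    have hw : weight L i.η (-(3 : ℝ)) j = ((L : ℝ) ^ j * i.η) ^ 3 := by
      rw [e3, B8ScaledSupNorm.weight_neg_natCast]
    have hw0 : 0 ≤ ((L : ℝ) ^ j * i.η) ^ 3 := by positivity
    have h1 : weight L i.η (-(3 : ℝ)) j * ‖Jcur i.η U₀ Ain b.2 b.1‖ ≤ nJi := by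
      rw [hnJi_def]; exact B8ScaledSupNorm.weight_mul_norm_le_msup hJbd hj hb
    have h2 : ((L : ℝ) ^ j * i.η) ^ 3 * ‖(ops M i m).Dp U₀ Ain b.1 b.2‖ ≤ c69 * M * (K₆ * α₀) * a := by
      rw [ha_def]; exact hcurv (K₆ * α₀) U₀ hU₀ ha₉0 ha3' hreg Ain hOn j hj b.1 b.2 hb
    have h4 : ((L : ℝ) ^ j * i.η) ^ 3 * ‖(ops M i m).QQ U₀ Ain b.1 b.2‖ ≤ q * nB := by
      rw [← hnB_eq]; exact havg U₀ hU₀ Ain hOn j hj b.1 b.2 hb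
    have hsum : ‖Jt b.1 b.2‖ ≤
        ‖Jcur i.η U₀ Ain b.2 b.1‖ + ‖(ops M i m).Dp U₀ Ain b.1 b.2‖ + ‖(ops M i m).QQ U₀ Ain b.1 b.2‖ := by
      rw [hJtb, hDRD b.1 b.2, add_zero]
      exact norm_add₃_le
    rw [hw] at h1 ⊢
    calc ((L : ℝ) ^ j * i.η) ^ 3 * ‖Jt b.1 b.2‖
        ≤ ((L : ℝ) ^ j * i.η) ^ 3 *
            (‖Jcur i.η U₀ Ain b.2 b.1‖ + ‖(ops M i m).Dp U₀ Ain b.1 b.2‖ + ‖(ops M i m).QQ U₀ Ain b.1 b.2‖) :=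
          mul_le_mul_of_nonneg_left hsum hw0
      _ = ((L : ℝ) ^ j * i.η) ^ 3 * ‖Jcur i.η U₀ Ain b.2 b.1‖ + ((L : ℝ) ^ j * i.η) ^ 3 * ‖(ops M i m).Dp U₀ Ain b.1 b.2‖ +
            ((L : ℝ) ^ j * i.η) ^ 3 * ‖(ops M i m).QQ U₀ Ain b.1 b.2‖ := by ring
      _ ≤ nJi + c69 * M * (K₆ * α₀) * a + q * nB := add_le_add (add_le_add h1 h2) h4
  -- Theorem 3.3's γ = −3 entries at J̃ through the dictionary ((3.47) ⇒ (1.59) for 𝟙_{Ω₀}A′)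
  obtain ⟨hw, hG0, hG1, hG3⟩ := hd U₀ hU₀ Jt
  have hline1 : a ≤ B₀ * bondNorm L m i.η (-(3 : ℝ)) i.Ω Jt := by
    have h := B9.glob_at_minus_three (GA (mem M i m)) h347 0 (ιLoc M i m Jt)
    rw [hG0, hw, hGJ, ← ha_def] at h
    exact h
  have hline2 : msup L m i.η (-(2 : ℝ)) (fun j (t : Fin d × Fin d × Site d) => SideTouches (i.Ω j) t.2.2 t.2.1)
      (fun t => covDerivFwd i.η U₀ t.1 (fun z => Ain z t.2.1) t.2.2) ≤ B₀ * bondNorm L m i.η (-(3 : ℝ)) i.Ω Jt := by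
    have h := B9.glob_at_minus_three (GA (mem M i m)) h347 1 (ιLoc M i m Jt)
    rw [hG1, hw, hGJ] at h
    exact h
  have hline4 : bondNorm L m i.η (-(3 : ℝ)) i.Ω (fun x μ => covLap i.η U₀ (fun z => Ain z μ) x) ≤
      B₀ * bondNorm L m i.η (-(3 : ℝ)) i.Ω Jt := by
    have h := B9.glob_at_minus_three (GA (mem M i m)) h347 3 (ιLoc M i m Jt)
    rw [hG3, hw, hGJ] at h
    exact h
  -- the a-priori (Neumann) step of G-IF-01 for 𝟙_{Ω₀}A′ with the source norm nJ + 16dΦ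
  have hN : bondNorm L m i.η (-(3 : ℝ)) i.Ω Jt ≤ (nJ + 16 * d * Φ) + c69 * M * (K₆ * α₀) * a + q * nB := by
    linarith only [hJt, hnJi_le]
  have hnJ1 : 0 ≤ nJ + 16 * d * Φ := by positivity
  obtain ⟨hA1, hA2, -, hA4, -⟩ := B9SupplySockB9P3Zd.apriori_arith (h := 0) (Cβ := 0) hB₀ hq hκ' hθ ha0 hnJ1 hnB0 le_rfl rfl hN hline1 hline2
    hline4 (by rw [zero_mul])
  -- bookkeeping constants
  obtain ⟨B', hB'_def⟩ : ∃ B' : ℝ, B' = max 1 (2 * B₀ * max 1 q) := ⟨_, rfl⟩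
  have hB'1 : 1 ≤ B' := by rw [hB'_def]; exact le_max_left _ _
  rw [← hB'_def] at hA1 hA2 hA4 ⊢
  -- the four lines for A′ = 𝟙_{Ω₀}A′ + outer part
  have hL1 : msup L m i.η (-(1 : ℝ)) (fun j (b : Site d × Fin d) => SideTouches (i.Ω j) b.1 b.2) (fun b => A' b.1 b.2) ≤ a + Φ := by
    rw [ha_def, hAin_def]
    exact B9SupplySockB9P3ZdLettersOmega.msup_side_le_restrict_add hη hMi hΦ0 hout hAbd
  have hL2 : msup L m i.η (-(2 : ℝ)) (fun j (t : Fin d × Fin d × Site d) => SideTouches (i.Ω j) t.2.2 t.2.1)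
      (fun t => covDerivFwd i.η U₀ t.1 (fun z => A' z t.2.1) t.2.2) ≤
      msup L m i.η (-(2 : ℝ)) (fun j (t : Fin d × Fin d × Site d) => SideTouches (i.Ω j) t.2.2 t.2.1)
        (fun t => covDerivFwd i.η U₀ t.1 (fun z => Ain z t.2.1) t.2.2) + 2 * Φ := by
    rw [hAin_def]
    exact B9SupplySockB9P3ZdLettersOmega.msup_grad_le_restrict_add hL hη hMi hU₀1 hΦ0 hout hAglob
  have hL4 : bondNorm L m i.η (-(3 : ℝ)) i.Ω (fun x μ => covLap i.η U₀ (fun z => A' z μ) x) ≤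
      bondNorm L m i.η (-(3 : ℝ)) i.Ω (fun x μ => covLap i.η U₀ (fun z => Ain z μ) x) + 4 * d * Φ := by
    rw [hAin_def]
    exact B9SupplySockB9P3ZdLettersOmega.bondNorm_covLap_le_restrict_add hL hη hMi hU₀1 hΦ0 hout hAglob
  have hJJ : bondNorm L m i.η (-(3 : ℝ)) i.Ω (fun x μ => pdiv i.η U₀ (plaqCovDeriv i.η U₀ A') μ x) = nJ := by
    rw [hnJ_def]; rfl
  -- name the remaining large terms, so that the final arithmetic runs on atoms
  obtain ⟨l1, hl1_def⟩ : ∃ l1 : ℝ,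
      l1 = msup L m i.η (-(1 : ℝ)) (fun j (b : Site d × Fin d) => SideTouches (i.Ω j) b.1 b.2) (fun b => A' b.1 b.2) := ⟨_, rfl⟩
  obtain ⟨l2, hl2_def⟩ : ∃ l2 : ℝ, l2 = msup L m i.η (-(2 : ℝ)) (fun j (t : Fin d × Fin d × Site d) => SideTouches (i.Ω j) t.2.2 t.2.1)
      (fun t => covDerivFwd i.η U₀ t.1 (fun z => A' z t.2.1) t.2.2) := ⟨_, rfl⟩
  obtain ⟨g2, hg2_def⟩ : ∃ g2 : ℝ, g2 = msup L m i.η (-(2 : ℝ)) (fun j (t : Fin d × Fin d × Site d) => SideTouches (i.Ω j) t.2.2 t.2.1)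
      (fun t => covDerivFwd i.η U₀ t.1 (fun z => Ain z t.2.1) t.2.2) := ⟨_, rfl⟩
  obtain ⟨l4, hl4_def⟩ : ∃ l4 : ℝ, l4 = bondNorm L m i.η (-(3 : ℝ)) i.Ω (fun x μ => covLap i.η U₀ (fun z => A' z μ) x) := ⟨_, rfl⟩
  obtain ⟨g4, hg4_def⟩ : ∃ g4 : ℝ, g4 = bondNorm L m i.η (-(3 : ℝ)) i.Ω (fun x μ => covLap i.η U₀ (fun z => Ain z μ) x) := ⟨_, rfl⟩
  rw [← hl1_def] at hL1
  rw [← hl2_def, ← hg2_def] at hL2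
  rw [← hg2_def] at hA2
  rw [← hl4_def, ← hg4_def] at hL4
  rw [← hg4_def] at hA4
  rw [← hnJ_def, ← hnB_def, ← hΦ_def, hJJ, ← hl1_def, ← hl2_def, ← hl4_def]
  have hd4 : (1 : ℝ) ≤ 4 * d + 2 := by linarith only [hd1]
  refine ⟨?_, ?_, ?_, ?_⟩
  · exact collar_arith (e := 1) hB'1 hΦ0 hd4 (by linarith only [hL1, hA1])
  · exact collar_arith (e := 2) hB'1 hΦ0 (by linarith only [hd1]) (by linarith only [hL2, hA2])
  · refine collar_arith (e := 0) hB'1 hΦ0 (by linarith only [hd1]) ?_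
    have h1 : nJ ≤ B' * nJ := le_mul_of_one_le_left hnJ0 hB'1
    have h2 : 0 ≤ B' * (16 * d * Φ + nB) := by positivity
    calc nJ ≤ B' * nJ := h1
      _ ≤ B' * nJ + B' * (16 * d * Φ + nB) := le_add_of_nonneg_right h2
      _ = B' * (nJ + 16 * d * Φ + nB) + 0 * Φ := by ring
  · exact collar_arith (e := 4 * d) hB'1 hΦ0 (by linarith only [hd1]) (by linarith only [hL4, hA4])

-- budget line (ops-buildfix standing ask for 100+-line weighted-norm proofs; elaborates well inside the default today)
set_option maxHeartbeats 400000 in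
/-- **(MEMBER-LOCAL HYPOTHESES — `B9SupplySockB9P3ZdOmega.sockB9P3_at_univ` re-proved on the At-binders.)  AT A MEMBER WITH `Ω₀ = ℤᵈ` THEOREM 3.3 SUPPLIES THE ORIGINAL FIVE-LINE SOCKET `SockB9P3`** (print's family `(T, □₁, …, □_k)`, B8 p. 77 «we
admit the case where some domains Ω_j are equal to T_η»; every bond is a bond of `Ω₀`, so E(Ω₀) is the consumer's class and there is no exterior
data) — g4's `B9SupplySockB9P3Zd.sockB9P3_at` re-run on the E(Ω₀)-binders, with the Hölder line from `HolderGlob` and both blocks of Theorem 3.3 at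
the member.  The supplier shape of the `SB9all` binder of the N05 record knit (dag-n05-d `…N05SubBHKnitUnivT8Srv`, keyed on `i.Ω 0 = Set.univ`).
[cite: Balaban1985RegularSpaces, (1.58)–(1.59) p.86, Prop. 3 p.87, p.77; Balaban1985BackgroundPropagators, Thm 3.3 p.399, (3.26)–(3.27) p.395, (3.43), (3.47) p.398, (3.69) p.404] -/
theorem sockB9P3_at_univ' (hd2 : 2 ≤ d) (hL : 1 ≤ L) {c35 c₆ K₆ a₃ c69 q CH β : ℝ} {len : Site d → ℝ}
    {M : ℝ} (hM1 : 1 ≤ M) (i : ZdIdx d L) (hΩ : i.Ω 0 = Set.univ) (m : ℕ)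
    (hdict : DictAt geo bg GA L mem ιCfg ιLoc ops M i m) (hP6 : Prop6At bg L mem ιCfg c35 c₆ K₆ M i m)
    (hinv : InvAt bg L mem ιCfg ops c35 a₃ M i m) (hcurv : CurvAt bg L mem ιCfg ops c35 a₃ c69 M i m)
    (hlan : LandauAt bg L mem ιCfg ops c35 a₃ M i m) (havg : AvgAt L ops q M i m)
    (hhol : HolderAt geo bg GA L mem ιCfg ops β len CH M i m)
    (hK₆ : 0 < K₆) (hc69 : 0 ≤ c69) (hq : 0 ≤ q)
    {B₀ δ₀ a₀ : ℝ} {Bβ Bε : ℝ → ℝ} {Bεβ : ℝ → ℝ → ℝ} (hB₀ : 0 < B₀)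
    (h33U : ∀ (α₀ : ℝ) (U₀ : Site d → Fin d → 𝔸ˣ) (hU₀ : ∀ x κ, U₀ x κ ∈ unitaryUnits 𝔸), 0 < α₀ → M * α₀ ≤ a₀ →
      (bg (mem M i m)).Reg335 c35 α₀ (ιCfg M i m U₀ hU₀) →
      B9.Ineq342_346_347 (GA (mem M i m)) B₀ δ₀ (ιCfg M i m U₀ hU₀) ∧
        B9.Ineq343_345 (GA (mem M i m)) Bβ Bε Bεβ δ₀ (ιCfg M i m U₀ hU₀)) :
    SockB9P3 (𝔸 := 𝔸) L (max 1 (2 * B₀ * max 1 q)) (2 * max 0 (CH * Bβ β) * max 1 q)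
      (min (1 / 16) (min (c₆ / M) (min (a₀ / (K₆ * M)) (min (a₃ / (K₆ * M)) (1 / (2 * B₀ * c69 * K₆ * M + 1))))))
      β len i.η m i.Ω i.Λs i.Λb := by
  intro α₀ α₂ hα₀ hα₀c hα₂ hα₂c U₀ W hU₀ hWu hInA _ hLanW A' _ h41 hA0
  -- the thresholds
  have hη : 0 < i.η := i.hη
  have hLr : (1 : ℝ) ≤ L := by exact_mod_cast hL
  have hM0 : 0 < M := lt_of_lt_of_le one_pos hM1
  have hKM : 0 < K₆ * M := mul_pos hK₆ hM0
  simp only [le_min_iff] at hα₀c hα₂c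
  obtain ⟨-, hα₀c6, hα₀a0, hα₀a3, hα₀θ⟩ := hα₀c
  obtain ⟨hα₂16, -, -, -, -⟩ := hα₂c
  have hc6 : M * α₀ ≤ c₆ := by rw [mul_comm]; exact (le_div_iff₀ hM0).1 hα₀c6
  have ha₉0 : 0 < K₆ * α₀ := mul_pos hK₆ hα₀
  have ha0' : M * (K₆ * α₀) ≤ a₀ := by
    have h := (le_div_iff₀ hKM).1 hα₀a0
    calc M * (K₆ * α₀) = α₀ * (K₆ * M) := by ring
      _ ≤ a₀ := h
  have ha3' : M * (K₆ * α₀) ≤ a₃ := by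
    have h := (le_div_iff₀ hKM).1 hα₀a3
    calc M * (K₆ * α₀) = α₀ * (K₆ * M) := by ring
      _ ≤ a₃ := h
  have hκ' : 0 ≤ c69 * M * (K₆ * α₀) := by positivity
  have hθ : B₀ * (c69 * M * (K₆ * α₀)) ≤ 1 / 2 := by
    have hpos : 0 < 2 * B₀ * c69 * K₆ * M + 1 := by positivity
    have h1 : α₀ * (2 * B₀ * c69 * K₆ * M + 1) ≤ 1 := (le_div_iff₀ hpos).1 hα₀θ
    linarith [hα₀.le]
  -- (3.35) for U₀ by Proposition 6, and Theorem 3.3's blocks for G(U₀)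
  have hreg : (bg (mem M i m)).Reg335 c35 (K₆ * α₀) (ιCfg M i m U₀ hU₀) := hP6 α₀ U₀ hU₀ hα₀ hc6 hInA
  obtain ⟨h347, h345⟩ := h33U (K₆ * α₀) U₀ hU₀ ha₉0 ha0' hreg
  obtain ⟨-, hd⟩ := hdict
  -- A′ is a field of the class E(Ω₀) = E (every bond is a bond of Ω₀ = ℤᵈ)
  have hU₀1 : ∀ x κ, U₀ x κ ∈ U1 𝔸 := fun x κ => unitaryUnits_le_U1 (hU₀ x κ)
  have hBT : ∀ (y : Site d) (τ : Fin d), BondTouches (i.Ω 0) y τ := fun y τ => Or.inl (by rw [hΩ]; exact Set.mem_univ y)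
  have hAbd : Bdd L m i.η (-(1 : ℝ)) (fun j (b : Site d × Fin d) => SideTouches (i.Ω j) b.1 b.2) (fun b => A' b.1 b.2) := by
    have e1 : (-(1 : ℝ)) = -((1 : ℕ) : ℝ) := by norm_num
    rw [e1]
    refine B8ScaledSupNorm.bdd_of_forall (c := α₂) fun j hj b hb => ?_
    rw [B8ScaledSupNorm.weight_neg_natCast, pow_one]
    have h := (h41 j hj b.1 b.2 hb).2
    have hs : 0 < (L : ℝ) ^ j * i.η := B8ScaledSupNorm.scale_pos hL hη j
    calc (L : ℝ) ^ j * i.η * ‖A' b.1 b.2‖ ≤ (L : ℝ) ^ j * i.η * (α₂ * ((L : ℝ) ^ j * i.η)⁻¹) :=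
          mul_le_mul_of_nonneg_left h hs.le
      _ = α₂ := by rw [mul_comm α₂, ← mul_assoc, mul_inv_cancel₀ hs.ne', one_mul]
  have hOn : OnDom L m i.η i.Ω A' := ⟨fun y τ h => absurd (hBT y τ) h, hAbd⟩
  obtain ⟨a, ha_def⟩ : ∃ a : ℝ,
      a = msup L m i.η (-(1 : ℝ)) (fun j (b : Site d × Fin d) => SideTouches (i.Ω j) b.1 b.2) (fun b => A' b.1 b.2) :=
    ⟨_, rfl⟩
  have ha0 : 0 ≤ a := by rw [ha_def]; exact B8ScaledSupNorm.msup_nonneg L m hη.le _ _ _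
  -- the Landau condition for A′; the source J̃ = Δ_a(U₀)A′ and A′ = G(U₀)J̃ ((1.58))
  have hLanA : IsLandau138 L m i.η (i.Ω 0) (i.Λs m) U₀ A' := B9SupplySockB9P3Zd.landau_of_landauW hd2 hη U₀ hWu hα₂16 h41 hLanW
  obtain ⟨Jt, hJt_def⟩ : ∃ Jt : Site d → Fin d → 𝔸, Jt = deltaAOf i.η (ops M i m) U₀ A' := ⟨_, rfl⟩
  have hGJ : (ops M i m).Gop U₀ Jt = A' :=
    hinv (K₆ * α₀) U₀ hU₀ ha₉0 ha3' hreg A' hOn Jt fun y τ _ => by rw [hJt_def]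
  have hDRD : ∀ (x : Site d) (μ : Fin d), (ops M i m).DRDs U₀ A' x μ = 0 :=
    hlan (K₆ * α₀) U₀ hU₀ ha₉0 ha3' hreg A' hOn hLanA
  have hJtb : ∀ (x : Site d) (μ : Fin d),
      Jt x μ = Jcur i.η U₀ A' μ x + (ops M i m).Dp U₀ A' x μ + (ops M i m).DRDs U₀ A' x μ + (ops M i m).QQ U₀ A' x μ := by
    intro x μ; rw [hJt_def]; rfl
  -- the right-hand side of the socket: |J|₍₋₃₎ and |B₁|
  obtain ⟨nJ, hnJ_def⟩ : ∃ nJ : ℝ, nJ = bondNorm L m i.η (-(3 : ℝ)) i.Ω (fun x μ => Jcur i.η U₀ A' μ x) := ⟨_, rfl⟩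
  obtain ⟨nB, hnB_def⟩ : ∃ nB : ℝ, nB = wsup 1 (fun p : {p : ℕ × (Site d × Fin d) // p.1 ≤ m ∧ p.2 ∈ i.Λb m p.1} =>
      linCovIter L U₀ (iEta i.η A') p.1.1 p.1.2.1 p.1.2.2) := ⟨_, rfl⟩
  have hnJ0 : 0 ≤ nJ := by rw [hnJ_def]; exact B8ScaledSupNorm.msup_nonneg L m hη.le _ _ _
  have hnB0 : 0 ≤ nB := by rw [hnB_def]; exact B8Eq155JBound.wsup_nonneg zero_le_one _
  -- J is bounded (A′ is)
  have hAglob : ∀ (y : Site d) (τ : Fin d), ‖A' y τ‖ ≤ α₂ * i.η⁻¹ := by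
    intro y τ
    by_cases hmem : ∃ j, j ≤ m ∧ SideTouches (i.Ω j) y τ
    · obtain ⟨j, hj, hs⟩ := hmem
      have hLj : (1 : ℝ) ≤ (L : ℝ) ^ j := one_le_pow₀ hLr
      calc ‖A' y τ‖ ≤ α₂ * ((L : ℝ) ^ j * i.η)⁻¹ := (h41 j hj y τ hs).2
        _ = α₂ * i.η⁻¹ * ((L : ℝ) ^ j)⁻¹ := by rw [mul_inv]; ring
        _ ≤ α₂ * i.η⁻¹ * 1 := by
            apply mul_le_mul_of_nonneg_left (inv_le_one_of_one_le₀ hLj) (by positivity)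
        _ = α₂ * i.η⁻¹ := mul_one _
    · rw [hA0 y τ fun j hj hs => hmem ⟨j, hj, hs⟩, norm_zero]
      positivity
  have hgrad : ∀ (y : Site d) (κ τ : Fin d), ‖covDerivFwd i.η U₀ κ (fun z => A' z τ) y‖ ≤ i.η⁻¹ * (α₂ * i.η⁻¹ + α₂ * i.η⁻¹) :=
    fun y κ τ => (B9SupplySockB9P3ZdLettersOmega.norm_covDerivFwd_le hη (hU₀1 _ _) _).trans
      (mul_le_mul_of_nonneg_left (add_le_add (hAglob _ _) (hAglob _ _)) (inv_nonneg.mpr hη.le))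
  have hJbd : Bdd L m i.η (-(3 : ℝ)) (fun j (b : Site d × Fin d) => BondTouches (i.Ω j) b.1 b.2)
      (fun b => Jcur i.η U₀ A' b.2 b.1) :=
    B9SupplySockB9P3Zd.bdd_neg_three_of_pointwise hL hη fun b => B9SupplySockB9P3Zd.norm_Jcur_le_of_grad hη hU₀1 hgrad b.2 b.1
  -- |J̃|₍₋₃₎ ≤ |J|₍₋₃₎ + c₆₉ M α₀ |A′|₍₋₁₎ + q |B₁| (pointwise: (3.26) with (3.69), the Landau condition, (3.16))
  have hJt : bondNorm L m i.η (-(3 : ℝ)) i.Ω Jt ≤ nJ + c69 * M * (K₆ * α₀) * a + q * nB := by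
    have e3 : (-(3 : ℝ)) = -((3 : ℕ) : ℝ) := by norm_num
    refine B8ScaledSupNorm.msup_le (by positivity) fun j hj b hb => ?_
    have hw : weight L i.η (-(3 : ℝ)) j = ((L : ℝ) ^ j * i.η) ^ 3 := by
      rw [e3, B8ScaledSupNorm.weight_neg_natCast]
    have hw0 : 0 ≤ ((L : ℝ) ^ j * i.η) ^ 3 := by positivity
    have h1 : weight L i.η (-(3 : ℝ)) j * ‖Jcur i.η U₀ A' b.2 b.1‖ ≤ nJ := by
      rw [hnJ_def]; exact B8ScaledSupNorm.weight_mul_norm_le_msup hJbd hj hb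
    have h2 : ((L : ℝ) ^ j * i.η) ^ 3 * ‖(ops M i m).Dp U₀ A' b.1 b.2‖ ≤ c69 * M * (K₆ * α₀) * a := by
      rw [ha_def]; exact hcurv (K₆ * α₀) U₀ hU₀ ha₉0 ha3' hreg A' hOn j hj b.1 b.2 hb
    have h4 : ((L : ℝ) ^ j * i.η) ^ 3 * ‖(ops M i m).QQ U₀ A' b.1 b.2‖ ≤ q * nB := by
      rw [hnB_def]; exact havg U₀ hU₀ A' hOn j hj b.1 b.2 hb
    have hsum : ‖Jt b.1 b.2‖ ≤
        ‖Jcur i.η U₀ A' b.2 b.1‖ + ‖(ops M i m).Dp U₀ A' b.1 b.2‖ + ‖(ops M i m).QQ U₀ A' b.1 b.2‖ := by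
      rw [hJtb, hDRD b.1 b.2, add_zero]
      exact norm_add₃_le
    rw [hw] at h1 ⊢
    calc ((L : ℝ) ^ j * i.η) ^ 3 * ‖Jt b.1 b.2‖
        ≤ ((L : ℝ) ^ j * i.η) ^ 3 *
            (‖Jcur i.η U₀ A' b.2 b.1‖ + ‖(ops M i m).Dp U₀ A' b.1 b.2‖ + ‖(ops M i m).QQ U₀ A' b.1 b.2‖) :=
          mul_le_mul_of_nonneg_left hsum hw0
      _ = ((L : ℝ) ^ j * i.η) ^ 3 * ‖Jcur i.η U₀ A' b.2 b.1‖ + ((L : ℝ) ^ j * i.η) ^ 3 * ‖(ops M i m).Dp U₀ A' b.1 b.2‖ +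
            ((L : ℝ) ^ j * i.η) ^ 3 * ‖(ops M i m).QQ U₀ A' b.1 b.2‖ := by ring
      _ ≤ nJ + c69 * M * (K₆ * α₀) * a + q * nB := add_le_add (add_le_add h1 h2) h4
  -- Theorem 3.3's γ = −3 entries at J̃ through the dictionary ((3.47) ⇒ (1.59)), and the Hölder binder
  obtain ⟨hw, hG0, hG1, hG3⟩ := hd U₀ hU₀ Jt
  have hline1 : a ≤ B₀ * bondNorm L m i.η (-(3 : ℝ)) i.Ω Jt := by
    have h := B9.glob_at_minus_three (GA (mem M i m)) h347 0 (ιLoc M i m Jt)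
    rw [hG0, hw, hGJ, ← ha_def] at h
    exact h
  have hline2 : msup L m i.η (-(2 : ℝ)) (fun j (t : Fin d × Fin d × Site d) => SideTouches (i.Ω j) t.2.2 t.2.1)
      (fun t => covDerivFwd i.η U₀ t.1 (fun z => A' z t.2.1) t.2.2) ≤ B₀ * bondNorm L m i.η (-(3 : ℝ)) i.Ω Jt := by
    have h := B9.glob_at_minus_three (GA (mem M i m)) h347 1 (ιLoc M i m Jt)
    rw [hG1, hw, hGJ] at h
    exact h
  have hline4 : bondNorm L m i.η (-(3 : ℝ)) i.Ω (fun x μ => covLap i.η U₀ (fun z => A' z μ) x) ≤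
      B₀ * bondNorm L m i.η (-(3 : ℝ)) i.Ω Jt := by
    have h := B9.glob_at_minus_three (GA (mem M i m)) h347 3 (ιLoc M i m Jt)
    rw [hG3, hw, hGJ] at h
    exact h
  have hline5 : msup L m i.η (-(2 + β))
      (fun j (q : Fin d × Fin d × (Site d × Site d)) => q.2.2 ∈ AdmPair i.η len ∧ q.2.2.1 ∈ i.Ω j)
      (fun q => hquot i.η β len U₀ (covDerivFwd i.η U₀ q.1 (fun z => A' z q.2.1)) q.2.2) ≤
      max 0 (CH * Bβ β) * bondNorm L m i.η (-(3 : ℝ)) i.Ω Jt := by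
    have h := hhol Bβ Bε Bεβ δ₀ U₀ hU₀ h345 Jt
    rw [hGJ] at h
    exact h.trans (mul_le_mul_of_nonneg_right (le_max_right _ _) (B8ScaledSupNorm.msup_nonneg L m hη.le _ _ _))
  -- the a-priori (Neumann) step of G-IF-01, in the concrete norms
  have hJJ : bondNorm L m i.η (-(3 : ℝ)) i.Ω (fun x μ => pdiv i.η U₀ (plaqCovDeriv i.η U₀ A') μ x) = nJ := by
    rw [hnJ_def]; rfl
  rw [← ha_def, ← hnJ_def, ← hnB_def]
  exact B9SupplySockB9P3Zd.apriori_arith hB₀ hq hκ' hθ ha0 hnJ0 hnB0 (le_max_left 0 _) hJJ hJt hline1 hline2 hline4 hline5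

-- budget line (ops-buildfix standing ask for 100+-line weighted-norm proofs; elaborates well inside the default today)
set_option maxHeartbeats 400000 in
/-- ★ **(MEMBER-LOCAL HYPOTHESES — `B9SupplySockB9P3ZdSrc.sockSrc_core_at_univ` re-proved on the At-binders.)  THE SOURCED JUNCTION AT A MEMBER WITH `Ω₀ = ℤᵈ`** (B8 Theorem 8's frame, p. 101: (1.58)–(1.59) with the gauge condition (1.146)): Theorem 3.3's two blocks
at `(M, i, m)` + `DictGlob` + `Prop6Feed` + `InvOnDom`∕`CurvSmallDom`∕`AvgBoundDom`∕`HolderGlob` + `GopAdd`∕`SourceTermDom`∕`SourceHolderDom` give, for every datum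
— `0 < α₀, α₂ ≤ cP`, `U₀ ∈ 𝔄_m` unitary-valued, a bond field `A′` with (1.41) `‖A′‖ ≤ α₂(Lʲη)⁻¹` on the sides of the plaquettes touching `Ω_j` (`j ≤ m`) and `A′ = 0` off
them, a source `f` with bounded `(Lʲη)²`-family and the multiplier clause «`R_m(U₀)(D^{η*}_{U₀}A′ − f) = 0`» — the five (1.59) lines: `|A′|₍₋₁₎, |∇A′|₍₋₂₎, |ΔA′|₍₋₃₎ ≤
B₀′(|J|₍₋₃₎ + |B₁|) + 2c_S|f|₍₋₂₎`, `|D*DA′|₍₋₃₎ ≤ B₀′(|J|₍₋₃₎ + |B₁|)`, Hölder `≤ B₀β′(|J|₍₋₃₎ + |B₁|) + (C_βc_S∕B₀ + c_Sβ)|f|₍₋₂₎`, with B₀′ = max{1, 2B₀max{1,q}},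
B₀β′ = 2C_βmax{1,q}, C_β = max{0, C_H Bβ(β)}, cP as in `B9SupplySockB9P3ZdOmega`.  Proof: `A′ ∈ E(Ω₀)` (every bond is a bond of `Ω₀`); `Δ_aA′ = J̃₁ + DRD*A′`,
`J̃₁ = J + Δ′A′ + Q*aQA′`; (1.58) + additivity: `G(U₀)J̃₁ = A′ − G(U₀)DRD*A′`; (3.69)∕(3.16): `|J̃₁|₍₋₃₎ ≤ |J|₍₋₃₎ + c₆₉MK₆α₀|A′|₍₋₁₎ + q|B₁|`; the frame's
(3.47)@−3 entries and `HolderGlob` bound the lines of `A′ − G(U₀)DRD*A′`, `SourceTermDom`∕`SourceHolderDom` those of `G(U₀)DRD*A′`; `apriori_arith_src`.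
[cite: Balaban1985RegularSpaces, Thm 8 + (1.146) p.101, (1.58)–(1.59) p.86, Prop. 3 p.87, p.92; Balaban1985BackgroundPropagators, Thm 3.3 p.399, (3.20)–(3.27) pp.394–395, (3.43), (3.47) p.398, (3.69) p.404] -/
theorem sockSrc_core_at_univ' (hL : 1 ≤ L) {c35 c₆ K₆ a₃ c69 q CH β cS cSβ : ℝ} {len : Site d → ℝ}
    {M : ℝ} (hM1 : 1 ≤ M) (i : ZdIdx d L) (hΩ : i.Ω 0 = Set.univ) (m : ℕ)
    (hdict : DictAt geo bg GA L mem ιCfg ιLoc ops M i m) (hP6 : Prop6At bg L mem ιCfg c35 c₆ K₆ M i m)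
    (hinv : InvAt bg L mem ιCfg ops c35 a₃ M i m) (hcurv : CurvAt bg L mem ιCfg ops c35 a₃ c69 M i m) (havg : AvgAt L ops q M i m)
    (hhol : HolderAt geo bg GA L mem ιCfg ops β len CH M i m) (hadd : GopAddAt L ops M i m)
    (hsrc : SrcAt bg L mem ιCfg ops c35 a₃ cS M i m) (hsrcH : SrcHolderAt bg L mem ιCfg ops c35 a₃ β len cSβ M i m)
    (hK₆ : 0 < K₆) (hc69 : 0 ≤ c69) (hq : 0 ≤ q) (hcS : 0 ≤ cS) (hcSβ : 0 ≤ cSβ)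
    {B₀ δ₀ a₀ : ℝ} {Bβ Bε : ℝ → ℝ} {Bεβ : ℝ → ℝ → ℝ} (hB₀ : 0 < B₀)
    (h33U : ∀ (α₀ : ℝ) (U₀ : Site d → Fin d → 𝔸ˣ) (hU₀ : ∀ x κ, U₀ x κ ∈ unitaryUnits 𝔸), 0 < α₀ → M * α₀ ≤ a₀ →
      (bg (mem M i m)).Reg335 c35 α₀ (ιCfg M i m U₀ hU₀) →
      B9.Ineq342_346_347 (GA (mem M i m)) B₀ δ₀ (ιCfg M i m U₀ hU₀) ∧
        B9.Ineq343_345 (GA (mem M i m)) Bβ Bε Bεβ δ₀ (ιCfg M i m U₀ hU₀)) :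
    ∀ α₀ α₂ : ℝ, 0 < α₀ →
      α₀ ≤ min (1 / 16) (min (c₆ / M) (min (a₀ / (K₆ * M)) (min (a₃ / (K₆ * M)) (1 / (2 * B₀ * c69 * K₆ * M + 1))))) →
      0 < α₂ → α₂ ≤ 1 / 16 →
    ∀ (U₀ : Site d → Fin d → 𝔸ˣ), (∀ x κ, U₀ x κ ∈ unitaryUnits 𝔸) → InAk L m i.η α₀ i.Ω U₀ →
    ∀ A' : Site d → Fin d → 𝔸,
    (∀ j, j ≤ m → ∀ (y : Site d) (τ : Fin d), SideTouches (i.Ω j) y τ → ‖A' y τ‖ ≤ α₂ * ((L : ℝ) ^ j * i.η)⁻¹) →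
    (∀ (y : Site d) (τ : Fin d), (∀ j, j ≤ m → ¬ SideTouches (i.Ω j) y τ) → A' y τ = 0) →
    ∀ f : Site d → 𝔸, Bdd L i.k i.η (-(2 : ℝ)) (fun j (x : Site d) => x ∈ i.Ω j) f →
    (∃ μ : ℕ → Site d → 𝔸, ∀ x ∈ i.Ω 0, covLap i.η U₀ ((i.Ω 0).indicator (covDivB i.η U₀ A' - f)) x = QT L m (i.Λs m) U₀ μ x) →
    msup L m i.η (-(1 : ℝ)) (fun j (b : Site d × Fin d) => SideTouches (i.Ω j) b.1 b.2) (fun b => A' b.1 b.2)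
        ≤ max 1 (2 * B₀ * max 1 q) * (bondNorm L m i.η (-(3 : ℝ)) i.Ω (fun x μ => Jcur i.η U₀ A' μ x)
          + wsup 1 (fun p : {p : ℕ × (Site d × Fin d) // p.1 ≤ m ∧ p.2 ∈ i.Λb m p.1} =>
              linCovIter L U₀ (iEta i.η A') p.1.1 p.1.2.1 p.1.2.2))
          + 2 * (cS * msup L i.k i.η (-(2 : ℝ)) (fun j (x : Site d) => x ∈ i.Ω j) f) ∧
      msup L m i.η (-(2 : ℝ)) (fun j (t : Fin d × Fin d × Site d) => SideTouches (i.Ω j) t.2.2 t.2.1)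
          (fun t => covDerivFwd i.η U₀ t.1 (fun z => A' z t.2.1) t.2.2)
        ≤ max 1 (2 * B₀ * max 1 q) * (bondNorm L m i.η (-(3 : ℝ)) i.Ω (fun x μ => Jcur i.η U₀ A' μ x)
          + wsup 1 (fun p : {p : ℕ × (Site d × Fin d) // p.1 ≤ m ∧ p.2 ∈ i.Λb m p.1} =>
              linCovIter L U₀ (iEta i.η A') p.1.1 p.1.2.1 p.1.2.2))
          + 2 * (cS * msup L i.k i.η (-(2 : ℝ)) (fun j (x : Site d) => x ∈ i.Ω j) f) ∧
      bondNorm L m i.η (-(3 : ℝ)) i.Ω (fun x μ => pdiv i.η U₀ (plaqCovDeriv i.η U₀ A') μ x)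
        ≤ max 1 (2 * B₀ * max 1 q) * (bondNorm L m i.η (-(3 : ℝ)) i.Ω (fun x μ => Jcur i.η U₀ A' μ x)
          + wsup 1 (fun p : {p : ℕ × (Site d × Fin d) // p.1 ≤ m ∧ p.2 ∈ i.Λb m p.1} =>
              linCovIter L U₀ (iEta i.η A') p.1.1 p.1.2.1 p.1.2.2)) ∧
      bondNorm L m i.η (-(3 : ℝ)) i.Ω (fun x μ => covLap i.η U₀ (fun z => A' z μ) x)
        ≤ max 1 (2 * B₀ * max 1 q) * (bondNorm L m i.η (-(3 : ℝ)) i.Ω (fun x μ => Jcur i.η U₀ A' μ x)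
          + wsup 1 (fun p : {p : ℕ × (Site d × Fin d) // p.1 ≤ m ∧ p.2 ∈ i.Λb m p.1} =>
              linCovIter L U₀ (iEta i.η A') p.1.1 p.1.2.1 p.1.2.2))
          + 2 * (cS * msup L i.k i.η (-(2 : ℝ)) (fun j (x : Site d) => x ∈ i.Ω j) f) ∧
      msup L m i.η (-(2 + β)) (fun j (q : Fin d × Fin d × (Site d × Site d)) => q.2.2 ∈ AdmPair i.η len ∧ q.2.2.1 ∈ i.Ω j)
          (fun q => hquot i.η β len U₀ (covDerivFwd i.η U₀ q.1 (fun z => A' z q.2.1)) q.2.2)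
        ≤ 2 * max 0 (CH * Bβ β) * max 1 q * (bondNorm L m i.η (-(3 : ℝ)) i.Ω (fun x μ => Jcur i.η U₀ A' μ x)
          + wsup 1 (fun p : {p : ℕ × (Site d × Fin d) // p.1 ≤ m ∧ p.2 ∈ i.Λb m p.1} =>
              linCovIter L U₀ (iEta i.η A') p.1.1 p.1.2.1 p.1.2.2))
          + (max 0 (CH * Bβ β) * (cS * msup L i.k i.η (-(2 : ℝ)) (fun j (x : Site d) => x ∈ i.Ω j) f) / B₀
            + cSβ * msup L i.k i.η (-(2 : ℝ)) (fun j (x : Site d) => x ∈ i.Ω j) f) := by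
  intro α₀ α₂ hα₀ hα₀c hα₂ hα₂16 U₀ hU₀ hInA A' h41 hA0 f hfB hcl
  -- the thresholds
  have hη : 0 < i.η := i.hη
  have hLr : (1 : ℝ) ≤ L := by exact_mod_cast hL
  have hM0 : 0 < M := lt_of_lt_of_le one_pos hM1
  have hKM : 0 < K₆ * M := mul_pos hK₆ hM0
  simp only [le_min_iff] at hα₀c
  obtain ⟨-, hα₀c6, hα₀a0, hα₀a3, hα₀θ⟩ := hα₀c
  have hc6 : M * α₀ ≤ c₆ := by rw [mul_comm]; exact (le_div_iff₀ hM0).1 hα₀c6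
  have ha₉0 : 0 < K₆ * α₀ := mul_pos hK₆ hα₀
  have ha0' : M * (K₆ * α₀) ≤ a₀ := by
    have h := (le_div_iff₀ hKM).1 hα₀a0
    calc M * (K₆ * α₀) = α₀ * (K₆ * M) := by ring
      _ ≤ a₀ := h
  have ha3' : M * (K₆ * α₀) ≤ a₃ := by
    have h := (le_div_iff₀ hKM).1 hα₀a3
    calc M * (K₆ * α₀) = α₀ * (K₆ * M) := by ring
      _ ≤ a₃ := h
  have hκ' : 0 ≤ c69 * M * (K₆ * α₀) := by positivity
  have hθ : B₀ * (c69 * M * (K₆ * α₀)) ≤ 1 / 2 := by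
    have hpos : 0 < 2 * B₀ * c69 * K₆ * M + 1 := by positivity
    have h1 : α₀ * (2 * B₀ * c69 * K₆ * M + 1) ≤ 1 := (le_div_iff₀ hpos).1 hα₀θ
    linarith [hα₀.le]
  -- (3.35) for U₀ by Proposition 6, and Theorem 3.3's blocks for G(U₀)
  have hreg : (bg (mem M i m)).Reg335 c35 (K₆ * α₀) (ιCfg M i m U₀ hU₀) := hP6 α₀ U₀ hU₀ hα₀ hc6 hInA
  obtain ⟨h347, h345⟩ := h33U (K₆ * α₀) U₀ hU₀ ha₉0 ha0' hreg
  obtain ⟨-, hd⟩ := hdict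
  -- A′ ∈ E(Ω₀) (every bond is a bond of Ω₀ = ℤᵈ); A′ uniformly bounded
  have hU₀1 : ∀ x κ, U₀ x κ ∈ U1 𝔸 := fun x κ => unitaryUnits_le_U1 (hU₀ x κ)
  have hBT : ∀ (y : Site d) (τ : Fin d), BondTouches (i.Ω 0) y τ := fun y τ => Or.inl (by rw [hΩ]; exact Set.mem_univ y)
  have hAbd : Bdd L m i.η (-(1 : ℝ)) (fun j (b : Site d × Fin d) => SideTouches (i.Ω j) b.1 b.2) (fun b => A' b.1 b.2) := by
    have e1 : (-(1 : ℝ)) = -((1 : ℕ) : ℝ) := by norm_num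
    rw [e1]
    refine B8ScaledSupNorm.bdd_of_forall (c := α₂) fun j hj b hb => ?_
    rw [B8ScaledSupNorm.weight_neg_natCast, pow_one]
    have h := h41 j hj b.1 b.2 hb
    have hs : 0 < (L : ℝ) ^ j * i.η := B8ScaledSupNorm.scale_pos hL hη j
    calc (L : ℝ) ^ j * i.η * ‖A' b.1 b.2‖ ≤ (L : ℝ) ^ j * i.η * (α₂ * ((L : ℝ) ^ j * i.η)⁻¹) :=
          mul_le_mul_of_nonneg_left h hs.le
      _ = α₂ := by rw [mul_comm α₂, ← mul_assoc, mul_inv_cancel₀ hs.ne', one_mul]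
  have hOn : OnDom L m i.η i.Ω A' := ⟨fun y τ h => absurd (hBT y τ) h, hAbd⟩
  have hAglob : ∀ (y : Site d) (τ : Fin d), ‖A' y τ‖ ≤ α₂ * i.η⁻¹ := by
    intro y τ
    by_cases hmem : ∃ j, j ≤ m ∧ SideTouches (i.Ω j) y τ
    · obtain ⟨j, hj, hs⟩ := hmem
      have hLj : (1 : ℝ) ≤ (L : ℝ) ^ j := one_le_pow₀ hLr
      calc ‖A' y τ‖ ≤ α₂ * ((L : ℝ) ^ j * i.η)⁻¹ := h41 j hj y τ hs
        _ = α₂ * i.η⁻¹ * ((L : ℝ) ^ j)⁻¹ := by rw [mul_inv]; ring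
        _ ≤ α₂ * i.η⁻¹ * 1 := by
            apply mul_le_mul_of_nonneg_left (inv_le_one_of_one_le₀ hLj) (by positivity)
        _ = α₂ * i.η⁻¹ := mul_one _
    · rw [hA0 y τ fun j hj hs => hmem ⟨j, hj, hs⟩, norm_zero]
      positivity
  obtain ⟨a, ha_def⟩ : ∃ a : ℝ,
      a = msup L m i.η (-(1 : ℝ)) (fun j (b : Site d × Fin d) => SideTouches (i.Ω j) b.1 b.2) (fun b => A' b.1 b.2) := ⟨_, rfl⟩
  have ha0 : 0 ≤ a := by rw [ha_def]; exact B8ScaledSupNorm.msup_nonneg L m hη.le _ _ _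
  -- the sources: J̃₁ = J + Δ′A′ + Q*aQA′ and the (1.146) term S = DRD*A′; Δ_aA′ = J̃₁ + S; (1.58) + additivity
  obtain ⟨Jt, hJt_def⟩ : ∃ Jt : Site d → Fin d → 𝔸,
      Jt = fun x μ => Jcur i.η U₀ A' μ x + (ops M i m).Dp U₀ A' x μ + (ops M i m).QQ U₀ A' x μ := ⟨_, rfl⟩
  obtain ⟨S, hS_def⟩ : ∃ S : Site d → Fin d → 𝔸, S = fun x μ => (ops M i m).DRDs U₀ A' x μ := ⟨_, rfl⟩
  have hGJS : (ops M i m).Gop U₀ (Jt + S) = A' := by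
    refine hinv (K₆ * α₀) U₀ hU₀ ha₉0 ha3' hreg A' hOn (Jt + S) fun y τ _ => ?_
    rw [hJt_def, hS_def]
    simp only [Pi.add_apply, deltaAOf]
    abel
  obtain ⟨GS, hGS_def⟩ : ∃ GS : Site d → Fin d → 𝔸, GS = (ops M i m).Gop U₀ S := ⟨_, rfl⟩
  have hGJ : (ops M i m).Gop U₀ Jt = A' - GS := by
    rw [hGS_def, eq_sub_iff_add_eq, ← hadd, hGJS]
  -- the source binder at (A′, f)
  obtain ⟨⟨C, hC⟩, hS1, hS2, hS4⟩ := hsrc (K₆ * α₀) U₀ hU₀ ha₉0 ha3' hreg A' hOn f hfB hcl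
  obtain ⟨hSbdd, hS5⟩ := hsrcH (K₆ * α₀) U₀ hU₀ ha₉0 ha3' hreg A' hOn f hfB hcl
  rw [← hS_def, ← hGS_def] at hC hS1 hS2 hS4 hSbdd hS5
  obtain ⟨F, hF_def⟩ : ∃ F : ℝ, F = msup L i.k i.η (-(2 : ℝ)) (fun j (x : Site d) => x ∈ i.Ω j) f := ⟨_, rfl⟩
  have hF0 : 0 ≤ F := by rw [hF_def]; exact B8ScaledSupNorm.msup_nonneg L i.k hη.le _ _ _
  rw [← hF_def] at hS1 hS2 hS4 hS5
  -- the right-hand side quantities: |J|₍₋₃₎ and |B₁|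
  obtain ⟨nJ, hnJ_def⟩ : ∃ nJ : ℝ, nJ = bondNorm L m i.η (-(3 : ℝ)) i.Ω (fun x μ => Jcur i.η U₀ A' μ x) := ⟨_, rfl⟩
  obtain ⟨nB, hnB_def⟩ : ∃ nB : ℝ, nB = wsup 1 (fun p : {p : ℕ × (Site d × Fin d) // p.1 ≤ m ∧ p.2 ∈ i.Λb m p.1} =>
      linCovIter L U₀ (iEta i.η A') p.1.1 p.1.2.1 p.1.2.2) := ⟨_, rfl⟩
  have hnJ0 : 0 ≤ nJ := by rw [hnJ_def]; exact B8ScaledSupNorm.msup_nonneg L m hη.le _ _ _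
  have hnB0 : 0 ≤ nB := by rw [hnB_def]; exact B8Eq155JBound.wsup_nonneg zero_le_one _
  -- J is bounded (A′ is)
  have hgrad : ∀ (y : Site d) (κ τ : Fin d), ‖covDerivFwd i.η U₀ κ (fun z => A' z τ) y‖ ≤ i.η⁻¹ * (α₂ * i.η⁻¹ + α₂ * i.η⁻¹) :=
    fun y κ τ => (B9SupplySockB9P3ZdLettersOmega.norm_covDerivFwd_le hη (hU₀1 _ _) _).trans
      (mul_le_mul_of_nonneg_left (add_le_add (hAglob _ _) (hAglob _ _)) (inv_nonneg.mpr hη.le))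
  have hJbd : Bdd L m i.η (-(3 : ℝ)) (fun j (b : Site d × Fin d) => BondTouches (i.Ω j) b.1 b.2)
      (fun b => Jcur i.η U₀ A' b.2 b.1) :=
    B9SupplySockB9P3Zd.bdd_neg_three_of_pointwise hL hη fun b => B9SupplySockB9P3Zd.norm_Jcur_le_of_grad hη hU₀1 hgrad b.2 b.1
  -- |J̃₁|₍₋₃₎ ≤ |J|₍₋₃₎ + c₆₉ M α₀ |A′|₍₋₁₎ + q |B₁| ((3.69), (3.16))
  have hJt : bondNorm L m i.η (-(3 : ℝ)) i.Ω Jt ≤ nJ + c69 * M * (K₆ * α₀) * a + q * nB := by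
    have e3 : (-(3 : ℝ)) = -((3 : ℕ) : ℝ) := by norm_num
    refine B8ScaledSupNorm.msup_le (by positivity) fun j hj b hb => ?_
    have hw : weight L i.η (-(3 : ℝ)) j = ((L : ℝ) ^ j * i.η) ^ 3 := by
      rw [e3, B8ScaledSupNorm.weight_neg_natCast]
    have hw0 : 0 ≤ ((L : ℝ) ^ j * i.η) ^ 3 := by positivity
    have h1 : weight L i.η (-(3 : ℝ)) j * ‖Jcur i.η U₀ A' b.2 b.1‖ ≤ nJ := by
      rw [hnJ_def]; exact B8ScaledSupNorm.weight_mul_norm_le_msup hJbd hj hb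
    have h2 : ((L : ℝ) ^ j * i.η) ^ 3 * ‖(ops M i m).Dp U₀ A' b.1 b.2‖ ≤ c69 * M * (K₆ * α₀) * a := by
      rw [ha_def]; exact hcurv (K₆ * α₀) U₀ hU₀ ha₉0 ha3' hreg A' hOn j hj b.1 b.2 hb
    have h4 : ((L : ℝ) ^ j * i.η) ^ 3 * ‖(ops M i m).QQ U₀ A' b.1 b.2‖ ≤ q * nB := by
      rw [hnB_def]; exact havg U₀ hU₀ A' hOn j hj b.1 b.2 hb
    have hsum : ‖Jt b.1 b.2‖ ≤
        ‖Jcur i.η U₀ A' b.2 b.1‖ + ‖(ops M i m).Dp U₀ A' b.1 b.2‖ + ‖(ops M i m).QQ U₀ A' b.1 b.2‖ := by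
      rw [hJt_def]
      exact norm_add₃_le
    rw [hw] at h1 ⊢
    calc ((L : ℝ) ^ j * i.η) ^ 3 * ‖Jt b.1 b.2‖
        ≤ ((L : ℝ) ^ j * i.η) ^ 3 *
            (‖Jcur i.η U₀ A' b.2 b.1‖ + ‖(ops M i m).Dp U₀ A' b.1 b.2‖ + ‖(ops M i m).QQ U₀ A' b.1 b.2‖) :=
          mul_le_mul_of_nonneg_left hsum hw0
      _ = ((L : ℝ) ^ j * i.η) ^ 3 * ‖Jcur i.η U₀ A' b.2 b.1‖ + ((L : ℝ) ^ j * i.η) ^ 3 * ‖(ops M i m).Dp U₀ A' b.1 b.2‖ +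
            ((L : ℝ) ^ j * i.η) ^ 3 * ‖(ops M i m).QQ U₀ A' b.1 b.2‖ := by ring
      _ ≤ nJ + c69 * M * (K₆ * α₀) * a + q * nB := add_le_add (add_le_add h1 h2) h4
  -- Theorem 3.3's γ = −3 entries at J̃₁ through the dictionary: the lines of A′ − GS
  obtain ⟨N, hN_def⟩ : ∃ N : ℝ, N = bondNorm L m i.η (-(3 : ℝ)) i.Ω Jt := ⟨_, rfl⟩
  rw [← hN_def] at hJt
  obtain ⟨hw, hG0, hG1, hG3⟩ := hd U₀ hU₀ Jt
  have hD1 : msup L m i.η (-(1 : ℝ)) (fun j (b : Site d × Fin d) => SideTouches (i.Ω j) b.1 b.2) (fun b => (A' - GS) b.1 b.2) ≤ B₀ * N := by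
    have h := B9.glob_at_minus_three (GA (mem M i m)) h347 0 (ιLoc M i m Jt)
    rw [hG0, hw, hGJ, ← hN_def] at h
    exact h
  have hD2 : msup L m i.η (-(2 : ℝ)) (fun j (t : Fin d × Fin d × Site d) => SideTouches (i.Ω j) t.2.2 t.2.1)
      (fun t => covDerivFwd i.η U₀ t.1 (fun z => (A' - GS) z t.2.1) t.2.2) ≤ B₀ * N := by
    have h := B9.glob_at_minus_three (GA (mem M i m)) h347 1 (ιLoc M i m Jt)
    rw [hG1, hw, hGJ, ← hN_def] at h
    exact h
  have hD4 : bondNorm L m i.η (-(3 : ℝ)) i.Ω (fun x μ => covLap i.η U₀ (fun z => (A' - GS) z μ) x) ≤ B₀ * N := by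
    have h := B9.glob_at_minus_three (GA (mem M i m)) h347 3 (ιLoc M i m Jt)
    rw [hG3, hw, hGJ, ← hN_def] at h
    exact h
  have hD5 : msup L m i.η (-(2 + β))
      (fun j (q : Fin d × Fin d × (Site d × Site d)) => q.2.2 ∈ AdmPair i.η len ∧ q.2.2.1 ∈ i.Ω j)
      (fun q => hquot i.η β len U₀ (covDerivFwd i.η U₀ q.1 (fun z => (A' - GS) z q.2.1)) q.2.2) ≤ max 0 (CH * Bβ β) * N := by
    have h := hhol Bβ Bε Bεβ δ₀ U₀ hU₀ h345 Jt
    rw [hGJ, ← hN_def] at h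
    exact h.trans (mul_le_mul_of_nonneg_right (le_max_right _ _) (by rw [hN_def]; exact B8ScaledSupNorm.msup_nonneg L m hη.le _ _ _))
  -- splitting A′ = (A′ − GS) + GS in the four local norms (bounded families) and in the Hölder functional (junk-aware)
  have hsplit : ∀ (y : Site d) (τ : Fin d), A' y τ = (A' - GS) y τ + GS y τ := fun y τ => by simp
  have hGSglob : ∀ (y : Site d) (τ : Fin d), ‖GS y τ‖ ≤ C := hC
  have hAGglob : ∀ (y : Site d) (τ : Fin d), ‖(A' - GS) y τ‖ ≤ α₂ * i.η⁻¹ + C := fun y τ => by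
    rw [Pi.sub_apply, Pi.sub_apply]
    exact (norm_sub_le _ _).trans (add_le_add (hAglob y τ) (hC y τ))
  have e1 : (-(1 : ℝ)) = -((1 : ℕ) : ℝ) := by norm_num
  have e2 : (-(2 : ℝ)) = -((2 : ℕ) : ℝ) := by norm_num
  have e3 : (-(3 : ℝ)) = -((3 : ℕ) : ℝ) := by norm_num
  have hL1 : a ≤ B₀ * N + cS * F := by
    rw [ha_def]
    refine (msup_le_add_of_norm_le hη.le (F := fun b : Site d × Fin d => (A' - GS) b.1 b.2) (G := fun b : Site d × Fin d => GS b.1 b.2)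
      (fun b => by rw [hsplit]; exact norm_add_le _ _) ?_ ?_).trans (add_le_add hD1 hS1)
    · rw [e1]; exact B9SupplySockB9P3ZdLettersOmega.bdd_neg_of_pointwise hL hη 1 fun b => hAGglob b.1 b.2
    · rw [e1]; exact B9SupplySockB9P3ZdLettersOmega.bdd_neg_of_pointwise hL hη 1 fun b => hGSglob b.1 b.2
  have hL2 : msup L m i.η (-(2 : ℝ)) (fun j (t : Fin d × Fin d × Site d) => SideTouches (i.Ω j) t.2.2 t.2.1)
      (fun t => covDerivFwd i.η U₀ t.1 (fun z => A' z t.2.1) t.2.2) ≤ B₀ * N + cS * F := by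
    refine (msup_le_add_of_norm_le hη.le
      (F := fun t : Fin d × Fin d × Site d => covDerivFwd i.η U₀ t.1 (fun z => (A' - GS) z t.2.1) t.2.2)
      (G := fun t : Fin d × Fin d × Site d => covDerivFwd i.η U₀ t.1 (fun z => GS z t.2.1) t.2.2)
      (fun t => ?_) ?_ ?_).trans (add_le_add hD2 hS2)
    · have h : (fun z => A' z t.2.1) = (fun z => (A' - GS) z t.2.1) + fun z => GS z t.2.1 := by
        funext z; simp
      rw [h, B8LambdaSpaceKLevel.covDerivFwd_add']
      exact norm_add_le _ _
    · rw [e2]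
      refine B9SupplySockB9P3ZdLettersOmega.bdd_neg_of_pointwise hL hη 2 (c := i.η⁻¹ * ((α₂ * i.η⁻¹ + C) + (α₂ * i.η⁻¹ + C))) fun t => ?_
      exact (B9SupplySockB9P3ZdLettersOmega.norm_covDerivFwd_le hη (hU₀1 _ _) _).trans
        (mul_le_mul_of_nonneg_left (add_le_add (hAGglob _ _) (hAGglob _ _)) (inv_nonneg.mpr hη.le))
    · rw [e2]
      refine B9SupplySockB9P3ZdLettersOmega.bdd_neg_of_pointwise hL hη 2 (c := i.η⁻¹ * (C + C)) fun t => ?_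
      exact (B9SupplySockB9P3ZdLettersOmega.norm_covDerivFwd_le hη (hU₀1 _ _) _).trans
        (mul_le_mul_of_nonneg_left (add_le_add (hGSglob _ _) (hGSglob _ _)) (inv_nonneg.mpr hη.le))
  have hL4 : bondNorm L m i.η (-(3 : ℝ)) i.Ω (fun x μ => covLap i.η U₀ (fun z => A' z μ) x) ≤ B₀ * N + cS * F := by
    unfold bondNorm at hD4 hS4 ⊢
    refine (msup_le_add_of_norm_le hη.le
      (F := fun b : Site d × Fin d => covLap i.η U₀ (fun z => (A' - GS) z b.2) b.1)
      (G := fun b : Site d × Fin d => covLap i.η U₀ (fun z => GS z b.2) b.1)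
      (fun b => ?_) ?_ ?_).trans (add_le_add hD4 hS4)
    · dsimp only
      have h : (fun z => A' z b.2) = (fun z => (A' - GS) z b.2) + fun z => GS z b.2 := by
        funext z; simp
      rw [h, B9SupplySockB9P3ZdLettersOmega.covLap_add]
      exact norm_add_le _ _
    · rw [e3]
      exact B9SupplySockB9P3ZdLettersOmega.bdd_neg_of_pointwise hL hη 3 fun b =>
        B9SupplySockB9P3ZdLettersOmega.norm_covLap_le hη hU₀1 (fun y => hAGglob y b.2) b.1
    · rw [e3]
      exact B9SupplySockB9P3ZdLettersOmega.bdd_neg_of_pointwise hL hη 3 fun b =>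
        B9SupplySockB9P3ZdLettersOmega.norm_covLap_le hη hU₀1 (fun y => hGSglob y b.2) b.1
  have hCβ0 : 0 ≤ max 0 (CH * Bβ β) := le_max_left _ _
  have hN0 : 0 ≤ N := by rw [hN_def]; exact B8ScaledSupNorm.msup_nonneg L m hη.le _ _ _
  have hL5 : msup L m i.η (-(2 + β))
      (fun j (q : Fin d × Fin d × (Site d × Site d)) => q.2.2 ∈ AdmPair i.η len ∧ q.2.2.1 ∈ i.Ω j)
      (fun q => hquot i.η β len U₀ (covDerivFwd i.η U₀ q.1 (fun z => A' z q.2.1)) q.2.2) ≤ max 0 (CH * Bβ β) * N + cSβ * F := by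
    by_cases hB : Bdd L m i.η (-(2 + β))
        (fun j (q : Fin d × Fin d × (Site d × Site d)) => q.2.2 ∈ AdmPair i.η len ∧ q.2.2.1 ∈ i.Ω j)
        (fun q => hquot i.η β len U₀ (covDerivFwd i.η U₀ q.1 (fun z => A' z q.2.1)) q.2.2)
    · -- bounded: the family of A′ − GS is bounded too, and the norm splits
      have hcd : ∀ q : Fin d × Fin d × (Site d × Site d),
          covDerivFwd i.η U₀ q.1 (fun z => (A' - GS) z q.2.1) =
            covDerivFwd i.η U₀ q.1 (fun z => A' z q.2.1) - covDerivFwd i.η U₀ q.1 (fun z => GS z q.2.1) := by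
        intro q
        funext x
        have h : (fun z => A' z q.2.1) = (fun z => (A' - GS) z q.2.1) + fun z => GS z q.2.1 := by
          funext z; simp
        rw [Pi.sub_apply, h, B8LambdaSpaceKLevel.covDerivFwd_add']
        abel
      have hcd' : ∀ q : Fin d × Fin d × (Site d × Site d),
          covDerivFwd i.η U₀ q.1 (fun z => A' z q.2.1) =
            covDerivFwd i.η U₀ q.1 (fun z => (A' - GS) z q.2.1) + covDerivFwd i.η U₀ q.1 (fun z => GS z q.2.1) := by
        intro q; rw [hcd]; abel
      have hBdiff : Bdd L m i.η (-(2 + β))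
          (fun j (q : Fin d × Fin d × (Site d × Site d)) => q.2.2 ∈ AdmPair i.η len ∧ q.2.2.1 ∈ i.Ω j)
          (fun q => hquot i.η β len U₀ (covDerivFwd i.η U₀ q.1 (fun z => (A' - GS) z q.2.1)) q.2.2) := by
        obtain ⟨c₁, hc₁⟩ := hB
        obtain ⟨c₂, hc₂⟩ := hSbdd
        refine ⟨c₁ + c₂, fun j hj q hq => ?_⟩
        have hw0 : 0 ≤ weight L i.η (-(2 + β)) j := B8ScaledSupNorm.weight_nonneg L hη.le _ j
        have hle : hquot i.η β len U₀ (covDerivFwd i.η U₀ q.1 (fun z => (A' - GS) z q.2.1)) q.2.2 ≤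
            hquot i.η β len U₀ (covDerivFwd i.η U₀ q.1 (fun z => A' z q.2.1)) q.2.2 +
              hquot i.η β len U₀ (covDerivFwd i.η U₀ q.1 (fun z => GS z q.2.1)) q.2.2 := by
          rw [hcd]; exact hquot_sub_le hη.le β U₀ _ _ hq.1
        have hn : ∀ r : ℝ, 0 ≤ r → ‖r‖ = r := fun r hr => Real.norm_of_nonneg hr
        have hq1 := B9Eq340HolderZd.hquot_nonneg hη.le β U₀ (covDerivFwd i.η U₀ q.1 (fun z => (A' - GS) z q.2.1)) hq.1
        have hq2 := B9Eq340HolderZd.hquot_nonneg hη.le β U₀ (covDerivFwd i.η U₀ q.1 (fun z => A' z q.2.1)) hq.1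
        have hq3 := B9Eq340HolderZd.hquot_nonneg hη.le β U₀ (covDerivFwd i.η U₀ q.1 (fun z => GS z q.2.1)) hq.1
        have h₁ := hc₁ j hj q hq
        have h₂ := hc₂ j hj q hq
        rw [hn _ hq2] at h₁
        rw [hn _ hq3] at h₂
        rw [hn _ hq1]
        calc weight L i.η (-(2 + β)) j * hquot i.η β len U₀ (covDerivFwd i.η U₀ q.1 (fun z => (A' - GS) z q.2.1)) q.2.2
            ≤ weight L i.η (-(2 + β)) j * (hquot i.η β len U₀ (covDerivFwd i.η U₀ q.1 (fun z => A' z q.2.1)) q.2.2 +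
              hquot i.η β len U₀ (covDerivFwd i.η U₀ q.1 (fun z => GS z q.2.1)) q.2.2) := mul_le_mul_of_nonneg_left hle hw0
          _ ≤ c₁ + c₂ := by rw [mul_add]; exact add_le_add h₁ h₂
      refine (msup_le_add_of_norm_le hη.le
        (F := fun q : Fin d × Fin d × (Site d × Site d) => hquot i.η β len U₀ (covDerivFwd i.η U₀ q.1 (fun z => (A' - GS) z q.2.1)) q.2.2)
        (G := fun q : Fin d × Fin d × (Site d × Site d) => hquot i.η β len U₀ (covDerivFwd i.η U₀ q.1 (fun z => GS z q.2.1)) q.2.2)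
        (fun q => ?_) hBdiff hSbdd).trans (add_le_add hD5 hS5)
      -- pointwise: on non-admissible pairs both sides may be junk, but the norm splitting only needs `‖x‖ ≤ ‖y‖ + ‖z‖`
      by_cases hq : q.2.2 ∈ AdmPair i.η len
      · have hq1 := B9Eq340HolderZd.hquot_nonneg hη.le β U₀ (covDerivFwd i.η U₀ q.1 (fun z => (A' - GS) z q.2.1)) hq
        have hq2 := B9Eq340HolderZd.hquot_nonneg hη.le β U₀ (covDerivFwd i.η U₀ q.1 (fun z => A' z q.2.1)) hq
        have hq3 := B9Eq340HolderZd.hquot_nonneg hη.le β U₀ (covDerivFwd i.η U₀ q.1 (fun z => GS z q.2.1)) hq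
        rw [Real.norm_of_nonneg hq1, Real.norm_of_nonneg hq2, Real.norm_of_nonneg hq3, hcd']
        exact hquot_add_le hη.le β U₀ _ _ hq
      · -- off the admissible pairs the quotient's denominator is the same on both sides: split the numerator
        simp only [B9Eq340HolderZd.hquot_def, hcd', Real.norm_eq_abs, abs_div]
        rw [← add_div]
        by_cases hden : |(i.η * len (q.2.2.2 - q.2.2.1)) ^ β| = 0
        · simp [hden]
        · refine div_le_div_of_nonneg_right ?_ (lt_of_le_of_ne (abs_nonneg _) (Ne.symm hden)).le
          rw [abs_of_nonneg (norm_nonneg _), abs_of_nonneg (norm_nonneg _), abs_of_nonneg (norm_nonneg _), Pi.add_apply, trans_add]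
          calc ‖trans U₀ q.2.2.1 q.2.2.2 (covDerivFwd i.η U₀ q.1 (fun z => (A' - GS) z q.2.1) q.2.2.2) +
                  trans U₀ q.2.2.1 q.2.2.2 (covDerivFwd i.η U₀ q.1 (fun z => GS z q.2.1) q.2.2.2) -
                (covDerivFwd i.η U₀ q.1 (fun z => (A' - GS) z q.2.1) q.2.2.1 + covDerivFwd i.η U₀ q.1 (fun z => GS z q.2.1) q.2.2.1)‖
              = ‖(trans U₀ q.2.2.1 q.2.2.2 (covDerivFwd i.η U₀ q.1 (fun z => (A' - GS) z q.2.1) q.2.2.2) -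
                    covDerivFwd i.η U₀ q.1 (fun z => (A' - GS) z q.2.1) q.2.2.1) +
                  (trans U₀ q.2.2.1 q.2.2.2 (covDerivFwd i.η U₀ q.1 (fun z => GS z q.2.1) q.2.2.2) -
                    covDerivFwd i.η U₀ q.1 (fun z => GS z q.2.1) q.2.2.1)‖ := by congr 1; abel
            _ ≤ _ := norm_add_le _ _
    · rw [msup_eq_zero_of_not_bdd hB]
      positivity
  -- the a-priori (Neumann) step with the additive source
  have hJJ : bondNorm L m i.η (-(3 : ℝ)) i.Ω (fun x μ => pdiv i.η U₀ (plaqCovDeriv i.η U₀ A') μ x) = nJ := by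
    rw [hnJ_def]; rfl
  have hSa : 0 ≤ cS * F := mul_nonneg hcS hF0
  obtain ⟨r1, r2, r3, r4, r5⟩ := apriori_arith_src (Sh := cSβ * F) hB₀ hq hκ' hθ ha0 hnJ0 hnB0 hCβ0 hSa hJt hL1 hL2 hL4 hL5
  rw [← ha_def, ← hnJ_def, ← hnB_def, hJJ, ← hF_def]
  exact ⟨r1, r2, r3, r4, r5⟩

end Supply

#print axioms sockB9P3D4_at'
#print axioms sockB9P3_at_univ'
#print axioms sockSrc_core_at_univ'

end Literature.MathematicalPhysics.QuantumFieldTheory.Balaban1983to89.B9SupplySockB9P3ZdAt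

end
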